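import Literature.MathematicalPhysics.QuantumFieldTheory.Balaban1983to89.Node00.Record13DatumKeyCoPH
import Literature.MathematicalPhysics.QuantumFieldTheory.Balaban1983to89.Node00.Record13DatumKeySepCoPR
import Literature.MathematicalPhysics.QuantumFieldTheory.Balaban1983to89.Node00.Record13SepCoPH

/-!
# NODE 00 (YM-PLAN Track A) — THE STAGE-13 DATUM ∕ RECORD KEYS ON THE PROVISOS OF RECORD OF THE v1.7 `CoPH` EDITION, `Stage13HParams.Provisos₁₃SepCoPH`
# (def-T `Node00/Record13SepCoPH` = RECORD 13 v1.7, FILE 28T): `IsDatumOfRecord₁₃CSepCoPH` (+ `.params ∕ .provisos`, `canon₁₃SepCoPH`, `IsRateKey₁₃SepCoPH`), the regime keys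
# `IsDatumOfRecord₁₃CSepCoPHOn ∕ IsRecordOfRecord₁₃CSepCoPHOn ∕ canon₁₃SepCoPHOn`, the CN keys `IsDatumOfRecord₁₃CSepCoPHN ∕ IsRecordOfRecord₁₃CSepCoPHN` at the re-issued guard
# `unityNondeg₁₃H N` (`Node00/Record13DatumKeyCoPH` §7), the one-way bridges INTO the `CoPH` keys (§8, along def-T's `Provisos₁₃SepCoPH.toCore`, datum by `rfl`) and the one-way
# history-blind doors `…SepCoPR → …SepCoPH` (§9, along def-T's `Stage13HParams.ofHistoryBlind`)

NODE 00 RECORD MODULE (cell `pub-ymgap`, seat `pub-ymgap-node00-def-RR-2` gen 13 = second reader ∕ key + instance side of the RATE-RECORD HOME, director-ym R141 (A);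
dag-lead «datum-KEY twin leaf = RR-2 lineage, one declarer»).  THE `SepCoPH` TWIN (v1.7 EDITION) of this seat's `Node00/Record13DatumKeySepCoPR` (p531941; the v1.6 item-facing
keys over `Stage13RParams.Provisos₁₃SepCoPR` and `datumOfRecord₁₃SepCoPR`).  THE v1.7 EDITION, SAID ONCE (def-T `LOCATED-9-ZetaHistoryBlind-DESIGN` §4 H1ʰ, KEYMAP v1.7, token map
T₇ + the FILE-28T names; FINDING №9 ∕ director-ym №183 H1ʰ): the residual 𝐓-weight of RECORD 13 is HISTORY-INDEXED — def-T's `structure Stage13HParams F N extends Stage13RParams F N`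
with the ONE new field `Zh : (p : B12.RunParams) → ℕ → (ℕ → Set (Site (F.P p.K) 0)) → (ℕ → Set (Site (F.P p.K) 0)) → TkResidualW F N (FluctV N) p.K` ([III] p.257 L31–34, p.267,
(3.23) p.270: `ζ^{(j)}` of THE TERM reads the term's history); the PROVISOS OF RECORD are `Stage13HParams.Provisos₁₃SepCoPH` (FILE 28T: the v1.6 rows of `Provisos₁₃SepCoPR` VERBATIM
at `θ.toStage13Params`, the residual rows `zhLaws ∕ zhLocal` on `θ.Zh`, the background-field row `bg` unchanged), with def-T's projection `Stage13HParams.Provisos₁₃SepCoPH.toCore :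
θ.Provisos₁₃SepCoPH F N → θ.Provisos₁₃CoPH F N` and the datum `datumOfRecord₁₃SepCoPH F N θ h :=` the core datum at `h.toCore` (`datumOfRecord₁₃SepCoPH_eq_coPH`, `rfl`); the record
predicate is `IsRecordOfRecord₁₃CSepCoPH` (+ `.toCoPH`).  The route's ITEM texts of the v1.7 revision key on these names (K0⁷ reads «`∃ θ : Stage13HParams F 2, ∃ h :
θ.Provisos₁₃SepCoPH F 2, (θ.ZhUnity F 2 ∧ θ.SlotsNondegenerate₁₃ F 2) ∧ θ.Admissible F 2 ∧ …`»; the ∀-items' binder prefix is `∀ (θ : Stage13HParams F N) (h : θ.Provisos₁₃SepCoPH F N),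
(θ.ZhUnity F N ∧ θ.SlotsNondegenerate₁₃ F N) → θ.Admissible F N → … (datumOfRecord₁₃SepCoPH F N θ h) …` = the literal face `forall_isRecordOfRecord₁₃CSepCoPHN_iff` below).  This module
is the token map applied to `Node00/Record13DatumKeySepCoPR` §1–§8: EVERY declaration of §1–§8 below is the v1.6-keyed declaration with binder `(θ : Stage13RParams F N) ↦ (θ :
Stage13HParams F N)` (also inside `Rg : (F : T4Family) → Stage13HParams F N → Prop` and the canonical readings' value types), `(h : θ.Provisos₁₃SepCoPR F N) ↦ (h :
θ.Provisos₁₃SepCoPH F N)`, `datumOfRecord₁₃SepCoPR ↦ datumOfRecord₁₃SepCoPH`, `θ.toStage5₁₃CoPR ↦ θ.toStage5₁₃CoPH`, `IsRecordOfRecord₁₃CSepCoPR… ↦ IsRecordOfRecord₁₃CSepCoPH…`,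
`θ.ZrUnity ↦ θ.ZhUnity`, `unityNondeg₁₃R ↦ unityNondeg₁₃H`, and in §8 the target classes `…CCoPR… ↦ …CCoPH…`, `IsRateKey₁₃CoPR ↦ IsRateKey₁₃CoPH`, bridge names `.toCoPR ↦ .toCoPH`,
in statement and proof, under the NAME RULE «def-T's token `SepCoPH` at def-T's position»: `IsDatumOfRecord₁₃CSepCoPR[On∕N] ↦ IsDatumOfRecord₁₃CSepCoPH[On∕N]`,
`IsRecordOfRecord₁₃CSepCoPR(On∕N) ↦ IsRecordOfRecord₁₃CSepCoPH(On∕N)`, `canon₁₃SepCoPR[On] ↦ canon₁₃SepCoPH[On]`, `IsRateKey₁₃SepCoPR ↦ IsRateKey₁₃SepCoPH`, the theorem stems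
likewise (the renamed face `IsDatumOfRecord₁₃CSepCoPRN.zrUnity ↦ IsDatumOfRecord₁₃CSepCoPHN.zhUnity`) — the 112 declarations of §1–§8 of the v1.6 leaf map onto the 112 of §1–§8 ONE
FOR ONE, statement AND proof (checked byte for byte against the landed file before filing).  The v1.6 leaf's §9 (the run-blind doors `…SepCoP → …SepCoPR` along
`Stage13RParams.ofRunBlind`) is NOT imaged (its image would need an embedding `Stage13Params → Stage13HParams` nobody declares); in its place §9 below files the SIX history-blind
doors `…SepCoPR → …SepCoPH` (NEW), with which the landed v1.5 → v1.6 doors compose.  KEYED FLAT on `datumOfRecord₁₃SepCoPH` (the token the v1.7 item texts carry).  APPEND-ONLY: a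
NEW leaf importing this seat's `Node00/Record13DatumKeyCoPH` (the `CoPH` keys and the guard `unityNondeg₁₃H`), this seat's `Node00/Record13DatumKeySepCoPR` (the v1.6 classes, for
§9) and def-T's `Node00/Record13SepCoPH`; NOTHING landed is edited — every earlier key module stands VERBATIM.

CONSUMED BY NAME from def-T's `Node00/Record13SepCoPH`: `Stage13HParams.Provisos₁₃SepCoPH` (+ `.toCore`), `datumOfRecord₁₃SepCoPH`, `datumOfRecord₁₃SepCoPH_eq_coPH`,
`IsRecordOfRecord₁₃CSepCoPH` (+ `.toCoPH`), `exists_world_isRecordOfRecord₁₃CSepCoPH`, `exists_provisos_of_isRecordOfRecord₁₃CSepCoPH`,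
`exists_isRecordOfRecord₅C_of_isRecordOfRecord₁₃CSepCoPH`, the `rfl` ∕ read-off faces `βfun_ ∕ flow_g_ ∕ av_ ∕ isDatumOfRecord₀_datumOfRecord₁₃SepCoPH`,
`isPrintedAveraged_datumOfRecord₁₃SepCoPH`, and — for §9 only — `Stage13RParams.Provisos₁₃SepCoPR.ofHistoryBlind`, `datumOfRecord₁₃SepCoPH_ofHistoryBlind`; from
`Node00/Record13CoPH`: `Stage13HParams`, `.ZhUnity`, `.toStage5₁₃CoPH`, `Stage13HParams.ofHistoryBlind`, `Stage13RParams.ZrUnity.ofHistoryBlind`,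
`Stage13HParams.toStage5₁₃CoPH_ofHistoryBlind`; from this seat's `Node00/Record13DatumKeyCoPH`: the `CoPH`-keyed classes and `unityNondeg₁₃H ∕ unityNondeg₁₃H_iff`; REUSED BY NAME
from `Node00/Record13DatumKey` (θ-level, proviso-free, background-free, residual-slot-free — NOT re-issued, cited at `θ.toStage13Params` by the consumers): `RateAssignment₁₃ ∕
SpineAssignment₁₃` and their lifts.  The key layer is PROVISO-FIELD-BLIND, BACKGROUND-BLIND and RESIDUAL-SLOT-BLIND (blind, in particular, to HOW a consumer reads the history —
def-T's DESIGN CALL (β) «prefix by type» lives in the weights, not here), which is why the re-key is a token map and every proof term of §1–§8 is the v1.6 proof term.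

WHY THIS OBJECT (as at every edition).  ONE canonical parameter per datum, `h.params := Classical.choose h` of `h : IsDatumOfRecord₁₃CSepCoPH F N D` (`h.provisos`, `h.admissible`,
`h.eq_datumOfRecord₁₃SepCoPH`); keyed records COHERENT (`exists_keyed_canon₁₃SepCoPH_iff`, `keyed_canon₁₃SepCoPH_coherent`); `IsDatumOfRecord₁₃CSepCoPH.forall_params`;
`isDatumOfRecord₁₃CSepCoPH_iff_exists_world` (the datum class IS def-T's `IsRecordOfRecord₁₃CSepCoPH` with the world forgotten); «`∃ D w, IsRecordOfRecord₁₃CSepCoPH F N D w`» REDUCES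
HONESTLY to «one admissible `Stage13HParams` with every field of `Provisos₁₃SepCoPH` a theorem» (`exists_isDatumOfRecord₁₃CSepCoPH_iff_exists_params`) — INHABITATION IS NOT CLAIMED
HERE.  `IsRateKey₁₃SepCoPH F N D w θ` is `IsRecordOfRecord₁₃CSepCoPH`'s body with θ EXPOSED (`Iff.rfl`).  THE REGIME KEYS (§4–§6) and the CN KEYS (§7, guard `unityNondeg₁₃H N F θ :=
θ.ZhUnity F N ∧ θ.SlotsNondegenerate₁₃ F N`, literal faces `isDatumOfRecord₁₃CSepCoPHN_iff`, `exists_isDatumOfRecord₁₃CSepCoPHN_iff_exists_params` (= K0⁷'s matrix read at `(F, 2)`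
up to its node conjuncts), `forall_isRecordOfRecord₁₃CSepCoPHN_iff`) read exactly as at v1.6.

§8 THE ONE-WAY BRIDGE SepCoPH → CoPH (INTO `Node00/Record13DatumKeyCoPH`).  `Provisos₁₃SepCoPH → Provisos₁₃CoPH` IS a lemma (def-T's `.toCore`, forgetting the `bg` row) and the
datum AGREES by `rfl` (`datumOfRecord₁₃SepCoPH_eq_coPH`), so every `SepCoPH`-keyed class instance is a `CoPH`-keyed one at the SAME datum, parameter and world, one application of
`h.toCore` each: `IsRateKey₁₃SepCoPH.toCoPH`, `IsDatumOfRecord₁₃CSepCoPH.toCoPH`, `IsDatumOfRecord₁₃CSepCoPHOn.toCoPH`, `IsRecordOfRecord₁₃CSepCoPHOn.toCoPH`,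
`IsDatumOfRecord₁₃CSepCoPHN.toCoPH`, `IsRecordOfRecord₁₃CSepCoPHN.toCoPH` (the record-level `IsRecordOfRecord₁₃CSepCoPH.toCoPH` is def-T's).  Use: a rate ∕ spine HOME keyed ONCE on
`IsRecordOfRecord₁₃CCoPH[On]` ∕ `datumOfRecord₁₃CoPH` is applied at a v1.7 item's tuple `(θ, h : θ.Provisos₁₃SepCoPH F N)` as `… θ h.toCore …`, the datum by `rfl`; NO converse
(`Provisos₁₃CoPH → Provisos₁₃SepCoPH` would assert a background-field bound from nothing).

§9 THE HISTORY-BLIND DOORS SepCoPR → SepCoPH (NEW; ONE-WAY).  Along def-T's embedding `Stage13HParams.ofHistoryBlind θ := ⟨θ, fun p _ _ _ => θ.Zr p⟩` (FILE 28T: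
`Stage13RParams.Provisos₁₃SepCoPR.ofHistoryBlind`, `datumOfRecord₁₃SepCoPH_ofHistoryBlind`; FILE 27: `Stage13RParams.ZrUnity.ofHistoryBlind`, `Stage13HParams.toStage5₁₃CoPH_ofHistoryBlind`)
every v1.6 `SepCoPR`-keyed class instance IS a v1.7 `SepCoPH`-keyed one AT THE SAME DATUM (and world): `IsDatumOfRecord₁₃CSepCoPH.ofCoPR`, `IsRateKey₁₃SepCoPH.ofCoPR`,
`IsDatumOfRecord₁₃CSepCoPHOn.ofCoPR ∕ IsRecordOfRecord₁₃CSepCoPHOn.ofCoPR` (given a regime transport), `IsDatumOfRecord₁₃CSepCoPHN.ofCoPR ∕ IsRecordOfRecord₁₃CSepCoPHN.ofCoPR` — with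
def-T's record-level `IsRecordOfRecord₁₃CSepCoPH.ofCoPR`, the whole of «K0⁷ ⇐ K0⁶» at class level (content-neutral at K0; the content of the v1.7 edition enters at K1⁷).  NO CONVERSE
exists or is claimed (FINDING №9: a history-indexed residual need not be history-blind); the landed v1.5 → v1.6 doors (`Node00/Record13DatumKeySepCoPR` §9) compose with §9 to give
v1.5 → v1.7 and are not re-issued; and, as at every edition, NO bridge from or to the ‴ ∕ ⁗ ∕ `SepMixed` ∕ `Co` ∕ `SepCo` keys is statable (different data of record).

WHAT IS NOT HERE.  NO edit of any landed key module or consumer; NO `CoPH → SepCoPH`, NO `SepCoPH → SepCoPR` bridge; NO `₁₂ ↔ ₁₃` key bridge; NO reading of any proviso row, of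
the background or of the residual slots `Zr ∕ Zh`; NO inhabitant of any key; the θ-level assignments and the guard are NOT re-declared (imported by name); def-T's record predicate
and its faces are NOT re-declared; NO `Provisos₁₃SepCoPH` inhabitant and NO record is claimed to exist.

HONEST FRAMING.  Definitions of record + kernel bookkeeping (`Classical.choose`, `rfl`, `dite`, ∃-repackaging) — a typing-faithfulness re-key (FINDING №9) of a CONDITIONAL
finite-𝕋⁴ record at fixed `ε`; NOTHING of Bałaban's is asserted; NO inhabitant of any key is claimed (the record's inhabitation item is OPEN); no node is discharged;
counts unmoved (COUNT-NEUTRAL); one finite four-torus programme at fixed `ε` — NOT the continuum limit on ℝ⁴, NOT infinite volume, NOT OS, NOT a mass gap, NOT the Clay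
problem.  No `sorry` ∕ `axiom` ∕ `opaque` ∕ `instance` ∕ `notation`.  [Balaban1989LargeFieldII] = Commun. Math. Phys. **122** (1989) 355–392; [III] = [Balaban1988Convergent] =
Commun. Math. Phys. **119** (1988) 243–285; [Balaban1988RG2Cluster] = Commun. Math. Phys. **116** (1988) 1–22; [Balaban1987RG1] = Commun. Math. Phys. **109** (1987) 249–301;
[15] = [Balaban1985Variational] = Commun. Math. Phys. **102** (1985) 277–309 and [6] = [Balaban1985RegularSpaces] = Commun. Math. Phys. **99** (1985) 75–102 cited for
orientation only, nothing of them asserted.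
-/

noncomputable section

namespace Literature.MathematicalPhysics.QuantumFieldTheory.Balaban1983to89.Node00

open T4Continuum AveragingRT T4FiniteEpsInhabited FlowStep FlowStepRuns DagBinding T4DatumAssembly

/-! ## §1. «`D` is a datum of record, Stage 13» and its CANONICAL parameter -/

section DatumKey

variable (F : T4Family) (N : ℕ) [NeZero N]

/-- **«`D` is a datum of record, Stage 13 (C-class)»**: SOME admissible Stage-13 parameter tuple satisfying its displayed provisos has `D` as its datum of record — the
datum-level shadow of `IsRecordOfRecord₁₃CSepCoPH` (the world forgotten; `isDatumOfRecord₁₃CSepCoPH_iff_exists_world`). [cite: Balaban1989LargeFieldII, Thm 1 + (0.1) pp.355–356; Balaban1988Convergent, Thms 1–2 pp.262–263 (objects of record; bookkeeping)] -/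
def IsDatumOfRecord₁₃CSepCoPH (D : FiniteEpsData F (SU N)) : Prop :=
  ∃ (θ : Stage13HParams F N) (h : θ.Provisos₁₃SepCoPH F N), θ.Admissible F N ∧ D = datumOfRecord₁₃SepCoPH F N θ h

/-- Every admissible Stage-13 parameter tuple with provisos yields a datum of record. [cite: Balaban1989LargeFieldII, Thm 1 + (0.1) pp.355–356 (bookkeeping)] -/
theorem isDatumOfRecord₁₃CSepCoPH_datumOfRecord₁₃SepCoPH (θ : Stage13HParams F N) (h : θ.Provisos₁₃SepCoPH F N) (hθ : θ.Admissible F N) :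
    IsDatumOfRecord₁₃CSepCoPH F N (datumOfRecord₁₃SepCoPH F N θ h) :=
  ⟨θ, h, hθ, rfl⟩

/-- **K0′ READS THE SAME AT THE DATUM**: some datum of record exists at `(F, N)` iff some Stage-13 record pair `(D, w)` exists (the body of the route's K0′
`Record12Inhabited` at `N`). [cite: Balaban1989LargeFieldII, Thm 1 + (0.1) pp.355–356 (bookkeeping)] -/
theorem exists_isDatumOfRecord₁₃CSepCoPH_iff_exists_record :
    (∃ D : FiniteEpsData F (SU N), IsDatumOfRecord₁₃CSepCoPH F N D) ↔ ∃ (D : FiniteEpsData F (SU N)) (w : WorldP), IsRecordOfRecord₁₃CSepCoPH F N D w := by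
  constructor
  · rintro ⟨_, θ, hP, hθ, rfl⟩
    obtain ⟨w, hw, -⟩ := exists_world_isRecordOfRecord₁₃CSepCoPH F N θ hP hθ ⟨hθ.toStage9.gamma_pos, le_rfl⟩
    exact ⟨_, w, hw⟩
  · rintro ⟨D, w, hw⟩
    exact ⟨D, exists_provisos_of_isRecordOfRecord₁₃CSepCoPH hw⟩

/-- **THE HONEST REDUCTION OF K0′**: some datum of record exists at `(F, N)` iff SOME Stage-13 parameter tuple is admissible and satisfies every displayed proviso —
«exhibit ONE admissible `Stage13HParams` with EVERY proviso field a theorem» (the K0′ components); inhabitation is NOT claimed in this module.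
[cite: Balaban1988Convergent, (2.7) p.255, (2.21) p.258, (2.28) p.259, (3.16) p.268, (3.21) p.269; Balaban1987RG1, (1.12)–(1.15) p.262 (hypothesis dictionary; bookkeeping)] -/
theorem exists_isDatumOfRecord₁₃CSepCoPH_iff_exists_params :
    (∃ D : FiniteEpsData F (SU N), IsDatumOfRecord₁₃CSepCoPH F N D) ↔ ∃ θ : Stage13HParams F N, θ.Provisos₁₃SepCoPH F N ∧ θ.Admissible F N := by
  constructor
  · rintro ⟨_, θ, hP, hθ, -⟩
    exact ⟨θ, hP, hθ⟩
  · rintro ⟨θ, hP, hθ⟩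
    exact ⟨_, isDatumOfRecord₁₃CSepCoPH_datumOfRecord₁₃SepCoPH F N θ hP hθ⟩

variable {F N}
variable {D : FiniteEpsData F (SU N)} {w : WorldP}

/-- A Stage-13 record's datum is a Stage-13 datum of record. [cite: Balaban1989LargeFieldII, Thm 1 p.355 (bookkeeping)] -/
theorem isDatumOfRecord₁₃CSepCoPH_of_isRecordOfRecord₁₃CSepCoPH (h : IsRecordOfRecord₁₃CSepCoPH F N D w) : IsDatumOfRecord₁₃CSepCoPH F N D :=
  exists_provisos_of_isRecordOfRecord₁₃CSepCoPH h

/-- **DATUM OF RECORD ⟺ RECORD AT SOME WORLD.** [cite: Balaban1989LargeFieldII, Thm 1 + (0.1) pp.355–356 (bookkeeping)] -/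
theorem isDatumOfRecord₁₃CSepCoPH_iff_exists_world : IsDatumOfRecord₁₃CSepCoPH F N D ↔ ∃ w : WorldP, IsRecordOfRecord₁₃CSepCoPH F N D w := by
  constructor
  · rintro ⟨θ, hP, hθ, rfl⟩
    obtain ⟨w, hw, -⟩ := exists_world_isRecordOfRecord₁₃CSepCoPH F N θ hP hθ ⟨hθ.toStage9.gamma_pos, le_rfl⟩
    exact ⟨w, hw⟩
  · rintro ⟨w, hw⟩
    exact isDatumOfRecord₁₃CSepCoPH_of_isRecordOfRecord₁₃CSepCoPH hw

/-- **THE CANONICAL STAGE-13 PARAMETER OF A DATUM OF RECORD** (choice) — the ONE key both carrier records of clusters K4 ∕ K5 are read at.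
[cite: Balaban1989LargeFieldII, Thm 1 + (0.1) pp.355–356 (bookkeeping)] -/
def IsDatumOfRecord₁₃CSepCoPH.params (h : IsDatumOfRecord₁₃CSepCoPH F N D) : Stage13HParams F N :=
  Classical.choose h

/-- Its provisos. [cite: Balaban1988Convergent, (2.7) p.255, (2.21) p.258, (2.35) p.261 (bookkeeping)] -/
theorem IsDatumOfRecord₁₃CSepCoPH.provisos (h : IsDatumOfRecord₁₃CSepCoPH F N D) : h.params.Provisos₁₃SepCoPH F N :=
  (Classical.choose_spec h).fst

/-- Its admissibility. [cite: Balaban1987RG1, (1.12) p.262; Balaban1988Convergent, (2.10) p.256 (bookkeeping)] -/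
theorem IsDatumOfRecord₁₃CSepCoPH.admissible (h : IsDatumOfRecord₁₃CSepCoPH F N D) : h.params.Admissible F N :=
  (Classical.choose_spec h).snd.1

/-- **The datum IS the datum of record of its canonical parameter.** [cite: Balaban1989LargeFieldII, Thm 1 p.355 (bookkeeping)] -/
theorem IsDatumOfRecord₁₃CSepCoPH.eq_datumOfRecord₁₃SepCoPH (h : IsDatumOfRecord₁₃CSepCoPH F N D) : D = datumOfRecord₁₃SepCoPH F N h.params h.provisos :=
  (Classical.choose_spec h).snd.2

/-- The canonical parameter's coupling window is positive. [cite: Balaban1987RG1, (0.21) p.256 (bookkeeping)] -/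
theorem IsDatumOfRecord₁₃CSepCoPH.gamma_pos (h : IsDatumOfRecord₁₃CSepCoPH F N D) : 0 < h.params.γ :=
  h.admissible.toStage9.gamma_pos

/-- … and lies inside `]0, 1[` (the Stage-12 sign `γ < 1` of the tuple's Stage-12 admissibility). [cite: Balaban1988Convergent, (2.28) p.259 (bookkeeping)] -/
theorem IsDatumOfRecord₁₃CSepCoPH.gamma_lt_one (h : IsDatumOfRecord₁₃CSepCoPH F N D) : h.params.γ < 1 :=
  h.admissible.toStage12.pos₁₂.2.2.2.2

/-- **WHAT A CONSUMER PROVES ⟹ WHAT THE INSTANCE CARRIES**: a property of the objects of record established at EVERY admissible Stage-13 parameter tuple with provisos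
holds at the canonical parameter of every datum of record. [cite: Balaban1989LargeFieldII, Thm 1 p.355 (bookkeeping)] -/
theorem IsDatumOfRecord₁₃CSepCoPH.forall_params {P : (D : FiniteEpsData F (SU N)) → (θ : Stage13HParams F N) → θ.Provisos₁₃SepCoPH F N → Prop}
    (hP : ∀ (θ : Stage13HParams F N) (hθ : θ.Provisos₁₃SepCoPH F N), θ.Admissible F N → P (datumOfRecord₁₃SepCoPH F N θ hθ) θ hθ) (h : IsDatumOfRecord₁₃CSepCoPH F N D) :
    P D h.params h.provisos := by
  have := hP h.params h.provisos h.admissible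
  rwa [← h.eq_datumOfRecord₁₃SepCoPH] at this

/-- **WORLD COMPANION IN `₁₃C` AT ANY WINDOW BELOW THE CANONICAL ONE**: for `0 < γw ≤ h.params.γ` some world makes `(D, w)` a Stage-13 record with `w.γ = γw` — what
the N17 home-keying binder («`RRec … R → ∃ w, IsRecordOfRecord₁₃CSepCoPH F N D w ∧ R.u3.γ = w.γ`») consumes once `R.u3.γ` is pinned in that range.
[cite: Balaban1989LargeFieldII, Thm 1 + (0.1) pp.355–356 (bookkeeping)] -/
theorem IsDatumOfRecord₁₃CSepCoPH.exists_world (h : IsDatumOfRecord₁₃CSepCoPH F N D) {γw : ℝ} (hγw : 0 < γw ∧ γw ≤ h.params.γ) :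
    ∃ w : WorldP, IsRecordOfRecord₁₃CSepCoPH F N D w ∧ w.γ = γw := by
  obtain ⟨w, hw, hγ⟩ := exists_world_isRecordOfRecord₁₃CSepCoPH F N h.params h.provisos h.admissible hγw
  exact ⟨w, h.eq_datumOfRecord₁₃SepCoPH ▸ hw, hγ⟩

/-- … in particular at the canonical window `h.params.γ` itself. [cite: Balaban1989LargeFieldII, Thm 1 + (0.1) pp.355–356 (bookkeeping)] -/
theorem IsDatumOfRecord₁₃CSepCoPH.exists_world_gamma (h : IsDatumOfRecord₁₃CSepCoPH F N D) :
    ∃ w : WorldP, IsRecordOfRecord₁₃CSepCoPH F N D w ∧ w.γ = h.params.γ :=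
  h.exists_world ⟨h.gamma_pos, le_rfl⟩

/-- **THE DATUM's β-FUNCTIONS ARE THE STAGE-13 β OF RECORD AT THE CANONICAL PARAMETER** (def-T's `βfun_datumOfRecord₁₃SepCoPH`, `rfl` there; `betaOfRecord₁₃ F N θ` over
`Stage13HParams` is def-T's reducible name for the β of record re-based on the canonical-version transport and the (2.9)-species small-field function — NOT `betaOfRecord₁₀` of Stages 10–12: the histories of record differ, and there is
NO ₁₂ ↔ ₁₃ key bridge in this module) — what the (D4) read-out binders and node N17 read off `D`.
[cite: Balaban1987RG1, (1.20)–(1.22) p.264 (bookkeeping)] -/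
theorem IsDatumOfRecord₁₃CSepCoPH.βfun_eq_betaOfRecord₁₃ (h : IsDatumOfRecord₁₃CSepCoPH F N D) : D.βfun = betaOfRecord₁₃ F N h.params.toStage13Params := by
  have := βfun_datumOfRecord₁₃SepCoPH F N h.params h.provisos
  rwa [← h.eq_datumOfRecord₁₃SepCoPH] at this

/-- The datum's coupling flow of the run `p` IS the Stage-13 generated history of record of the canonical parameter (def-T's `flow_g_datumOfRecord₁₃SepCoPH`).
[cite: Balaban1987RG1, (0.17)–(0.20) pp.255–256 (bookkeeping)] -/
theorem IsDatumOfRecord₁₃CSepCoPH.flow_g (h : IsDatumOfRecord₁₃CSepCoPH F N D) (p : B12.RunParams) :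
    (D.C p).flow.g = gOfRecord₁₃ F N h.params.toStage13Params p := by
  have := flow_g_datumOfRecord₁₃SepCoPH F N h.params h.provisos p
  rwa [← h.eq_datumOfRecord₁₃SepCoPH] at this

/-- The datum's averaging maps ARE the averaging maps of record. [cite: Balaban1987RG1, (0.4) p.253 (bookkeeping)] -/
theorem IsDatumOfRecord₁₃CSepCoPH.av_eq (h : IsDatumOfRecord₁₃CSepCoPH F N D) : D.av = avOfRecord F N := by
  have := av_datumOfRecord₁₃SepCoPH F N h.params h.provisos
  rwa [← h.eq_datumOfRecord₁₃SepCoPH] at this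

/-- A Stage-13 datum of record is a datum of record, Stage 0 (binder B1 ∕ node N23's reading). [cite: Balaban1987RG1, (0.3)–(0.4) p.253 (bookkeeping)] -/
theorem IsDatumOfRecord₁₃CSepCoPH.isDatumOfRecord₀ (h : IsDatumOfRecord₁₃CSepCoPH F N D) : IsDatumOfRecord₀ F N D := by
  rw [h.eq_datumOfRecord₁₃SepCoPH]
  exact isDatumOfRecord₀_datumOfRecord₁₃SepCoPH F N h.params h.provisos

/-- N23 · binder B1 at every Stage-13 datum of record. [cite: Balaban1987RG1, (0.4) p.253] -/
theorem IsDatumOfRecord₁₃CSepCoPH.isPrintedAveraged (h : IsDatumOfRecord₁₃CSepCoPH F N D) : D.IsPrintedAveraged := by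
  rw [h.eq_datumOfRecord₁₃SepCoPH]
  exact isPrintedAveraged_datumOfRecord₁₃SepCoPH F N h.params h.provisos

/-- **THE ₅C SHADOW AT THE CANONICAL PARAMETER**: a Stage-13 datum of record is refined by a Stage-5 C-bound record at some world (def-T's
`exists_isRecordOfRecord₅C_of_isRecordOfRecord₁₃CSepCoPH` through the world companion) — for consumers keyed at ₅C. [cite: Balaban1989LargeFieldII, Thm 1 + (0.1) pp.355–356 (bookkeeping)] -/
theorem IsDatumOfRecord₁₃CSepCoPH.exists_isRecordOfRecord₅C (h : IsDatumOfRecord₁₃CSepCoPH F N D) :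
    ∃ (D₅ : FiniteEpsData F (SU N)) (w : WorldP), IsRecordOfRecord₅C F N D₅ w ∧ D₅.C = D.C ∧ (∀ K g₀ k, D₅.dens K g₀ k = D.dens K g₀ k) ∧
      D₅.βfun = D.βfun ∧ D₅.av = D.av := by
  obtain ⟨w, hw, -⟩ := h.exists_world_gamma
  obtain ⟨D₅, h₅⟩ := exists_isRecordOfRecord₅C_of_isRecordOfRecord₁₃CSepCoPH hw
  exact ⟨D₅, w, h₅⟩

end DatumKey

/-! ## §2. Canonicalised readings — COHERENCE for records keyed «`∃ θ hP, θ.Admissible F N ∧ D = datumOfRecord₁₃SepCoPH F N θ hP ∧ S = cr F θ hP …`»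

Reading an existentially keyed record through `canon₁₃SepCoPH f` makes the admitted bundle a function of the DATUM: `canon₁₃SepCoPH f θ hP = f h.params h.provisos` whenever
`datumOfRecord₁₃SepCoPH F N θ hP = D` and `h : IsDatumOfRecord₁₃CSepCoPH F N D` (`canon₁₃SepCoPH_eq_of_eq`), so two records keyed independently but read through `canon₁₃SepCoPH` admit, at the
same `(F, D, g₀, os)`, bundles read at the SAME parameter (`exists_keyed_canon₁₃SepCoPH_iff` turns either key into «`∃ h : IsDatumOfRecord₁₃CSepCoPH F N D, Φ (f h.params
h.provisos)`»).  Off the datum-of-record class `canon₁₃SepCoPH f = f`. -/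
section Canon

variable (F : T4Family) (N : ℕ) [NeZero N] {α : Sort*}

/-- **CANONICALISED READING**: read `f` at the canonical parameter of the datum `datumOfRecord₁₃SepCoPH F N θ hP` when that datum is of record (admissible), else at
`(θ, hP)` itself.  Kernel bookkeeping (`Classical.dec`, `dite`). [cite: Balaban1989LargeFieldII, Thm 1 + (0.1) pp.355–356 (bookkeeping)] -/
def canon₁₃SepCoPH (f : (θ : Stage13HParams F N) → θ.Provisos₁₃SepCoPH F N → α) (θ : Stage13HParams F N) (hP : θ.Provisos₁₃SepCoPH F N) : α := by
  classical
  exact if h : IsDatumOfRecord₁₃CSepCoPH F N (datumOfRecord₁₃SepCoPH F N θ hP) then f h.params h.provisos else f θ hP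

variable {F N}

/-- The canonical parameter depends on the datum only: transport of the key along `D = D'` does not change `.params` (proof irrelevance + `subst`).
[cite: Balaban1989LargeFieldII, Thm 1 + (0.1) pp.355–356 (bookkeeping)] -/
theorem IsDatumOfRecord₁₃CSepCoPH.params_congr {D D' : FiniteEpsData F (SU N)} (h : IsDatumOfRecord₁₃CSepCoPH F N D) (h' : IsDatumOfRecord₁₃CSepCoPH F N D') (e : D = D') :
    h.params = h'.params := by
  subst e
  rfl

/-- **`canon₁₃SepCoPH f θ hP = f h.params h.provisos`** whenever `(θ, hP)` realises a datum of record `D` with key `h`. [cite: Balaban1989LargeFieldII, Thm 1 + (0.1) pp.355–356 (bookkeeping)] -/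
theorem canon₁₃SepCoPH_eq_of_eq {f : (θ : Stage13HParams F N) → θ.Provisos₁₃SepCoPH F N → α} {D : FiniteEpsData F (SU N)} (h : IsDatumOfRecord₁₃CSepCoPH F N D)
    (θ : Stage13HParams F N) (hP : θ.Provisos₁₃SepCoPH F N) (e : D = datumOfRecord₁₃SepCoPH F N θ hP) :
    canon₁₃SepCoPH F N f θ hP = f h.params h.provisos := by
  subst e
  unfold canon₁₃SepCoPH
  rw [dif_pos h]

/-- At the canonical parameter itself `canon₁₃SepCoPH f` reads `f`. [cite: Balaban1989LargeFieldII, Thm 1 + (0.1) pp.355–356 (bookkeeping)] -/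
theorem canon₁₃SepCoPH_params {f : (θ : Stage13HParams F N) → θ.Provisos₁₃SepCoPH F N → α} {D : FiniteEpsData F (SU N)} (h : IsDatumOfRecord₁₃CSepCoPH F N D) :
    canon₁₃SepCoPH F N f h.params h.provisos = f h.params h.provisos :=
  canon₁₃SepCoPH_eq_of_eq h h.params h.provisos h.eq_datumOfRecord₁₃SepCoPH

/-- At an admissible tuple with provisos, `canon₁₃SepCoPH f` reads `f` at the canonical parameter of ITS datum. [cite: Balaban1989LargeFieldII, Thm 1 + (0.1) pp.355–356 (bookkeeping)] -/
theorem canon₁₃SepCoPH_eq_of_admissible {f : (θ : Stage13HParams F N) → θ.Provisos₁₃SepCoPH F N → α} (θ : Stage13HParams F N) (hP : θ.Provisos₁₃SepCoPH F N) (hθ : θ.Admissible F N) :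
    canon₁₃SepCoPH F N f θ hP = f (isDatumOfRecord₁₃CSepCoPH_datumOfRecord₁₃SepCoPH F N θ hP hθ).params (isDatumOfRecord₁₃CSepCoPH_datumOfRecord₁₃SepCoPH F N θ hP hθ).provisos :=
  canon₁₃SepCoPH_eq_of_eq _ θ hP rfl

/-- Off the datum-of-record class nothing is canonicalised. [cite: Balaban1989LargeFieldII, Thm 1 + (0.1) pp.355–356 (bookkeeping)] -/
theorem canon₁₃SepCoPH_eq_self_of_not {f : (θ : Stage13HParams F N) → θ.Provisos₁₃SepCoPH F N → α} (θ : Stage13HParams F N) (hP : θ.Provisos₁₃SepCoPH F N)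
    (hn : ¬ IsDatumOfRecord₁₃CSepCoPH F N (datumOfRecord₁₃SepCoPH F N θ hP)) : canon₁₃SepCoPH F N f θ hP = f θ hP := by
  unfold canon₁₃SepCoPH
  rw [dif_neg hn]

/-- **THE KEYED-RECORD FACE**: an existentially keyed record («some admissible `θ` with provisos realises `D` and the bundle reads `canon₁₃SepCoPH f` there») IS the
datum-keyed record («the bundle reads `f` at the canonical parameter of `D`») — for every property `Φ` of the reading (e.g. `Φ x := S = x g₀ os`).  This is the
sentence that makes (T-SPINE)'s and (T-RATE)'s Stage-13 records COHERENT. [cite: Balaban1989LargeFieldII, Thm 1 + (0.1) pp.355–356 (bookkeeping)] -/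
theorem exists_keyed_canon₁₃SepCoPH_iff {f : (θ : Stage13HParams F N) → θ.Provisos₁₃SepCoPH F N → α} {D : FiniteEpsData F (SU N)} (Φ : α → Prop) :
    (∃ (θ : Stage13HParams F N) (hP : θ.Provisos₁₃SepCoPH F N), θ.Admissible F N ∧ D = datumOfRecord₁₃SepCoPH F N θ hP ∧ Φ (canon₁₃SepCoPH F N f θ hP)) ↔
      ∃ h : IsDatumOfRecord₁₃CSepCoPH F N D, Φ (f h.params h.provisos) := by
  constructor
  · rintro ⟨θ, hP, hθ, e, hΦ⟩
    have h : IsDatumOfRecord₁₃CSepCoPH F N D := ⟨θ, hP, hθ, e⟩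
    refine ⟨h, ?_⟩
    rwa [canon₁₃SepCoPH_eq_of_eq (f := f) h θ hP e] at hΦ
  · rintro ⟨h, hΦ⟩
    refine ⟨h.params, h.provisos, h.admissible, h.eq_datumOfRecord₁₃SepCoPH, ?_⟩
    rwa [canon₁₃SepCoPH_params (f := f) h]

/-- **COHERENCE**: two existentially keyed records read through `canon₁₃SepCoPH` admit, at the same datum, readings AT THE SAME PARAMETER.
[cite: Balaban1989LargeFieldII, Thm 1 + (0.1) pp.355–356 (bookkeeping)] -/
theorem keyed_canon₁₃SepCoPH_coherent {β : Sort*} {f : (θ : Stage13HParams F N) → θ.Provisos₁₃SepCoPH F N → α} {g : (θ : Stage13HParams F N) → θ.Provisos₁₃SepCoPH F N → β}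
    {D : FiniteEpsData F (SU N)} (Φ : α → Prop) (Ψ : β → Prop)
    (hΦ : ∃ (θ : Stage13HParams F N) (hP : θ.Provisos₁₃SepCoPH F N), θ.Admissible F N ∧ D = datumOfRecord₁₃SepCoPH F N θ hP ∧ Φ (canon₁₃SepCoPH F N f θ hP))
    (hΨ : ∃ (θ : Stage13HParams F N) (hP : θ.Provisos₁₃SepCoPH F N), θ.Admissible F N ∧ D = datumOfRecord₁₃SepCoPH F N θ hP ∧ Ψ (canon₁₃SepCoPH F N g θ hP)) :
    ∃ h : IsDatumOfRecord₁₃CSepCoPH F N D, Φ (f h.params h.provisos) ∧ Ψ (g h.params h.provisos) := by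
  obtain ⟨h, h₁⟩ := (exists_keyed_canon₁₃SepCoPH_iff Φ).1 hΦ
  obtain ⟨h', h₂⟩ := (exists_keyed_canon₁₃SepCoPH_iff Ψ).1 hΨ
  exact ⟨h, h₁, h₂⟩

end Canon

/-! ## §3. The θ-exposed Stage-13 record key `IsRateKey₁₃SepCoPH` and the residual ASSIGNMENTS of the rate-record home at Stage 13 (`RateAssignment₁₃` ∕ `SpineAssignment₁₃` over
`Stage13HParams`, with the one-token lifts `.ofStage12` ∕ `.ofStage9` of the Stage-12 ∕ Stage-9-typed assignments; RR-1's object containers BY NAME) -/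

section Key

variable (F : T4Family) (N : ℕ) [NeZero N]

/-- **«(D, w) is the Stage-13 record WITH PARAMETERS θ»**: the body of `IsRecordOfRecord₁₃CSepCoPH F N D w` with the Stage-13 parameter tuple EXPOSED — θ is admissible and
satisfies its displayed provisos, its datum of record IS `D`, and the world `w` is bound to the construction with a window `0 < w.γ ≤ θ.γ`, Bałaban's block size and
the C-binding of record over the Stage-13 view. [cite: Balaban1989LargeFieldII, Thm 1 + (0.1) pp.355–356; Balaban1987RG1, (0.24)–(0.25) p.257 (objects of record; bookkeeping)] -/
def IsRateKey₁₃SepCoPH (D : FiniteEpsData F (SU N)) (w : WorldP) (θ : Stage13HParams F N) : Prop :=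
  ∃ h : θ.Provisos₁₃SepCoPH F N, θ.Admissible F N ∧ D = datumOfRecord₁₃SepCoPH F N θ h ∧ w.C = D.C ∧ (0 < w.γ ∧ w.γ ≤ θ.γ) ∧
    w.L = (θ.L : ℝ) ∧ ∀ P : B12.RunParams, w.up P = upOfRecord₅C F N (θ.toStage5₁₃CoPH F N) P

/-- **A Stage-13 record IS a keyed record for SOME θ, and conversely** (`Iff.rfl`: the key is `IsRecordOfRecord₁₃CSepCoPH`'s body). [cite: Balaban1989LargeFieldII, Thm 1 + (0.1) pp.355–356 (bookkeeping)] -/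
theorem isRecordOfRecord₁₃CSepCoPH_iff_exists_isRateKey₁₃SepCoPH (D : FiniteEpsData F (SU N)) (w : WorldP) :
    IsRecordOfRecord₁₃CSepCoPH F N D w ↔ ∃ θ : Stage13HParams F N, IsRateKey₁₃SepCoPH F N D w θ := Iff.rfl

/-- **Pointed form of the key** at the datum of record. [cite: Balaban1989LargeFieldII, Thm 1 + (0.1) pp.355–356 (bookkeeping)] -/
theorem isRateKey₁₃SepCoPH_of_eq (θ : Stage13HParams F N) (h : θ.Provisos₁₃SepCoPH F N) (hθ : θ.Admissible F N) (w : WorldP)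
    (hC : w.C = (datumOfRecord₁₃SepCoPH F N θ h).C) (hγ : 0 < w.γ ∧ w.γ ≤ θ.γ) (hL : w.L = (θ.L : ℝ))
    (hup : ∀ P, w.up P = upOfRecord₅C F N (θ.toStage5₁₃CoPH F N) P) :
    IsRateKey₁₃SepCoPH F N (datumOfRecord₁₃SepCoPH F N θ h) w θ :=
  ⟨h, hθ, rfl, hC, hγ, hL, hup⟩

/-- **Every admissible θ satisfying its provisos is keyed at some world with any window `0 < γw ≤ θ.γ`** — inhabitation of the keyed class is Stage 13's exactly.
[cite: Balaban1989LargeFieldII, Thm 1 + (0.1) pp.355–356 (bookkeeping)] -/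
theorem exists_world_isRateKey₁₃SepCoPH (θ : Stage13HParams F N) (h : θ.Provisos₁₃SepCoPH F N) (hθ : θ.Admissible F N) {γw : ℝ} (hγw : 0 < γw ∧ γw ≤ θ.γ) :
    ∃ w : WorldP, IsRateKey₁₃SepCoPH F N (datumOfRecord₁₃SepCoPH F N θ h) w θ ∧ w.γ = γw := by
  obtain ⟨w₀⟩ := nonempty_worldP
  exact ⟨{ w₀ with
      C := (datumOfRecord₁₃SepCoPH F N θ h).C, γ := γw, L := (θ.L : ℝ), one_lt_L := by exact_mod_cast θ.hL.2,
      up := fun P => upOfRecord₅C F N (θ.toStage5₁₃CoPH F N) P },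
    ⟨h, hθ, rfl, rfl, hγw, rfl, fun _ => rfl⟩, rfl⟩

variable {F N}
variable {D : FiniteEpsData F (SU N)} {w : WorldP} {θ : Stage13HParams F N}

/-- A keyed record is a Stage-13 record. [cite: Balaban1989LargeFieldII, Thm 1 + (0.1) pp.355–356 (bookkeeping)] -/
theorem IsRateKey₁₃SepCoPH.isRecordOfRecord₁₃CSepCoPH (hk : IsRateKey₁₃SepCoPH F N D w θ) : IsRecordOfRecord₁₃CSepCoPH F N D w := ⟨θ, hk⟩

/-- … hence its datum is a Stage-13 datum of record. [cite: Balaban1989LargeFieldII, Thm 1 p.355 (bookkeeping)] -/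
theorem IsRateKey₁₃SepCoPH.isDatumOfRecord₁₃CSepCoPH (hk : IsRateKey₁₃SepCoPH F N D w θ) : IsDatumOfRecord₁₃CSepCoPH F N D :=
  isDatumOfRecord₁₃CSepCoPH_of_isRecordOfRecord₁₃CSepCoPH hk.isRecordOfRecord₁₃CSepCoPH

/-- The key CERTIFIES θ's provisos and admissibility and realises `D` as θ's datum of record. [cite: Balaban1989LargeFieldI, (0.3)–(0.4) p.176 (bookkeeping)] -/
theorem IsRateKey₁₃SepCoPH.exists_provisos (hk : IsRateKey₁₃SepCoPH F N D w θ) : ∃ h : θ.Provisos₁₃SepCoPH F N, θ.Admissible F N ∧ D = datumOfRecord₁₃SepCoPH F N θ h := by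
  obtain ⟨h, hθ, hD, -⟩ := hk
  exact ⟨h, hθ, hD⟩

/-- The key's θ is admissible. [cite: Balaban1987RG1, (1.20)–(1.21) p.264 (hypothesis dictionary; bookkeeping)] -/
theorem IsRateKey₁₃SepCoPH.admissible (hk : IsRateKey₁₃SepCoPH F N D w θ) : θ.Admissible F N := by
  obtain ⟨-, hθ, -⟩ := hk
  exact hθ

/-- The world's window is positive. [cite: Balaban1987RG1, Thm 1 p.259 (bookkeeping)] -/
theorem IsRateKey₁₃SepCoPH.gamma_pos (hk : IsRateKey₁₃SepCoPH F N D w θ) : 0 < w.γ := by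
  obtain ⟨-, -, -, -, hγ, -⟩ := hk
  exact hγ.1

/-- The world's window sits inside θ's coupling window: `w.γ ≤ θ.γ`. [cite: Balaban1987RG1, Thm 1 p.259 (bookkeeping)] -/
theorem IsRateKey₁₃SepCoPH.gamma_le (hk : IsRateKey₁₃SepCoPH F N D w θ) : w.γ ≤ θ.γ := by
  obtain ⟨-, -, -, -, hγ, -⟩ := hk
  exact hγ.2

/-- The world reads θ's block factor. [cite: Balaban1987RG1, (0.1) p.251 (bookkeeping)] -/
theorem IsRateKey₁₃SepCoPH.L_eq (hk : IsRateKey₁₃SepCoPH F N D w θ) : w.L = (θ.L : ℝ) := by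
  obtain ⟨-, -, -, -, -, hL, -⟩ := hk
  exact hL

/-- The world is bound to the datum's construction. [cite: Balaban1989LargeFieldII, Thm 1 + (0.1) pp.355–356 (bookkeeping)] -/
theorem IsRateKey₁₃SepCoPH.construction_eq (hk : IsRateKey₁₃SepCoPH F N D w θ) : w.C = D.C := by
  obtain ⟨-, -, -, hC, -⟩ := hk
  exact hC

/-- The upstream block of the world is the C-binding of record at the Stage-13 view. [cite: Balaban1989LargeFieldII, Thm 1 + (0.1) pp.355–356 (bookkeeping)] -/
theorem IsRateKey₁₃SepCoPH.up_eq (hk : IsRateKey₁₃SepCoPH F N D w θ) (P : B12.RunParams) : w.up P = upOfRecord₅C F N (θ.toStage5₁₃CoPH F N) P := by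
  obtain ⟨-, -, -, -, -, -, hup⟩ := hk
  exact hup P

end Key


/-! ## §4. «`D` is a datum of record, Stage 13, realised IN THE REGIME `Rg`» and its canonical parameter in the regime -/

section DatumKeyOn

variable (F : T4Family) (N : ℕ) [NeZero N]

/-- **«`D` is a datum of record, Stage 13, realised in the regime `Rg`»**: SOME admissible Stage-13 parameter tuple IN `Rg` satisfying its displayed provisos has `D` as its datum
of record — the common key prefix of the regime-restricted carrier homes (the Stage-13 re-keys of `YMDAG.UVSplit.RRec₁₂On 𝔯 Rg` ∕ `SRec₁₂On cr Rg`).  At `Rg := ⊤` it is the C key (`isDatumOfRecord₁₃CSepCoPHOn_true_iff`).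
[cite: Balaban1989LargeFieldII, Thm 1 + (0.1) pp.355–356; Balaban1988Convergent, Thms 1–2 pp.262–263 (objects of record; bookkeeping)] -/
def IsDatumOfRecord₁₃CSepCoPHOn (Rg : (F : T4Family) → Stage13HParams F N → Prop) (D : FiniteEpsData F (SU N)) : Prop :=
  ∃ (θ : Stage13HParams F N) (h : θ.Provisos₁₃SepCoPH F N), Rg F θ ∧ θ.Admissible F N ∧ D = datumOfRecord₁₃SepCoPH F N θ h

variable (Rg : (F : T4Family) → Stage13HParams F N → Prop)

/-- Unfolding (`Iff.rfl`). [cite: Balaban1989LargeFieldII, Thm 1 + (0.1) pp.355–356 (bookkeeping)] -/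
theorem isDatumOfRecord₁₃CSepCoPHOn_iff (D : FiniteEpsData F (SU N)) :
    IsDatumOfRecord₁₃CSepCoPHOn F N Rg D ↔ ∃ (θ : Stage13HParams F N) (h : θ.Provisos₁₃SepCoPH F N), Rg F θ ∧ θ.Admissible F N ∧ D = datumOfRecord₁₃SepCoPH F N θ h :=
  Iff.rfl

/-- Every admissible Stage-13 parameter tuple in the regime with provisos yields a datum of record in the regime. [cite: Balaban1989LargeFieldII, Thm 1 + (0.1) pp.355–356 (bookkeeping)] -/
theorem isDatumOfRecord₁₃CSepCoPHOn_datumOfRecord₁₃SepCoPH (θ : Stage13HParams F N) (h : θ.Provisos₁₃SepCoPH F N) (hRg : Rg F θ) (hθ : θ.Admissible F N) :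
    IsDatumOfRecord₁₃CSepCoPHOn F N Rg (datumOfRecord₁₃SepCoPH F N θ h) :=
  ⟨θ, h, hRg, hθ, rfl⟩

/-- **THE HONEST REDUCTION, IN THE REGIME**: some datum of record in `Rg` exists at `(F, N)` iff SOME Stage-13 parameter tuple satisfies every displayed proviso, lies in `Rg` and
is admissible; inhabitation is NOT claimed in this module. [cite: Balaban1988Convergent, (2.7) p.255, (2.21) p.258, (3.16)–(3.22) pp.268–269; Balaban1987RG1, (1.12)–(1.15) p.262 (hypothesis dictionary; bookkeeping)] -/
theorem exists_isDatumOfRecord₁₃CSepCoPHOn_iff_exists_params :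
    (∃ D : FiniteEpsData F (SU N), IsDatumOfRecord₁₃CSepCoPHOn F N Rg D) ↔ ∃ θ : Stage13HParams F N, θ.Provisos₁₃SepCoPH F N ∧ Rg F θ ∧ θ.Admissible F N := by
  constructor
  · rintro ⟨_, θ, hP, hRg, hθ, -⟩
    exact ⟨θ, hP, hRg, hθ⟩
  · rintro ⟨θ, hP, hRg, hθ⟩
    exact ⟨_, isDatumOfRecord₁₃CSepCoPHOn_datumOfRecord₁₃SepCoPH F N Rg θ hP hRg hθ⟩

/-- **A PROPERTY OF EVERY DATUM OF RECORD IN THE REGIME ⟺ THE θ-KEYED SENTENCE GUARDED BY `Rg`** (datum level). [cite: Balaban1989LargeFieldII, Thm 1 + (0.1) pp.355–356 (bookkeeping)] -/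
theorem forall_isDatumOfRecord₁₃CSepCoPHOn_iff (P : FiniteEpsData F (SU N) → Prop) :
    (∀ D : FiniteEpsData F (SU N), IsDatumOfRecord₁₃CSepCoPHOn F N Rg D → P D) ↔
      ∀ (θ : Stage13HParams F N) (h : θ.Provisos₁₃SepCoPH F N), Rg F θ → θ.Admissible F N → P (datumOfRecord₁₃SepCoPH F N θ h) := by
  constructor
  · intro hall θ h hRg hθ
    exact hall _ (isDatumOfRecord₁₃CSepCoPHOn_datumOfRecord₁₃SepCoPH F N Rg θ h hRg hθ)
  · rintro hall D ⟨θ, h, hRg, hθ, rfl⟩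
    exact hall θ h hRg hθ

variable {F N Rg}
variable {D : FiniteEpsData F (SU N)}

/-- The regime forgotten: a datum of record in `Rg` is a datum of record (C key). [cite: Balaban1989LargeFieldII, Thm 1 p.355 (bookkeeping)] -/
theorem IsDatumOfRecord₁₃CSepCoPHOn.toC (h : IsDatumOfRecord₁₃CSepCoPHOn F N Rg D) : IsDatumOfRecord₁₃CSepCoPH F N D := by
  obtain ⟨θ, hP, -, hθ, hD⟩ := h
  exact ⟨θ, hP, hθ, hD⟩

/-- Monotone in the regime. [cite: Balaban1989LargeFieldII, Thm 1 p.355 (bookkeeping)] -/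
theorem IsDatumOfRecord₁₃CSepCoPHOn.mono {Rg' : (F : T4Family) → Stage13HParams F N → Prop} (hle : ∀ (F : T4Family) (θ : Stage13HParams F N), Rg F θ → Rg' F θ)
    (h : IsDatumOfRecord₁₃CSepCoPHOn F N Rg D) : IsDatumOfRecord₁₃CSepCoPHOn F N Rg' D := by
  obtain ⟨θ, hP, hRg, hθ, hD⟩ := h
  exact ⟨θ, hP, hle F θ hRg, hθ, hD⟩

/-- At the trivial regime the key IS the C key. [cite: Balaban1989LargeFieldII, Thm 1 p.355 (bookkeeping)] -/
theorem isDatumOfRecord₁₃CSepCoPHOn_true_iff : IsDatumOfRecord₁₃CSepCoPHOn F N (fun _ _ => True) D ↔ IsDatumOfRecord₁₃CSepCoPH F N D :=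
  ⟨fun h => h.toC, fun ⟨θ, hP, hθ, hD⟩ => ⟨θ, hP, trivial, hθ, hD⟩⟩

/-- A datum of record whose C-CANONICAL parameter lies in the regime is a datum of record in the regime (companion of the (T-RATE) home's `rRec₁₂On_of_regime_params`, re-keyed).
[cite: Balaban1989LargeFieldII, Thm 1 p.355 (bookkeeping)] -/
theorem IsDatumOfRecord₁₃CSepCoPH.isDatumOfRecord₁₃CSepCoPHOn_of_regime_params (h : IsDatumOfRecord₁₃CSepCoPH F N D) (hRg : Rg F h.params) : IsDatumOfRecord₁₃CSepCoPHOn F N Rg D :=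
  ⟨h.params, h.provisos, hRg, h.admissible, h.eq_datumOfRecord₁₃SepCoPH⟩

/-- **THE CANONICAL STAGE-13 PARAMETER OF A DATUM OF RECORD IN THE REGIME** (choice).  HONEST: it need not equal the C-canonical parameter `h.toC.params` of the same datum
(two choices over two existentials); the regime reaches THIS parameter (`.regime`), never `IsDatumOfRecord₁₃CSepCoPH.params`. [cite: Balaban1989LargeFieldII, Thm 1 + (0.1) pp.355–356 (bookkeeping)] -/
def IsDatumOfRecord₁₃CSepCoPHOn.params (h : IsDatumOfRecord₁₃CSepCoPHOn F N Rg D) : Stage13HParams F N :=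
  Classical.choose h

/-- Its provisos. [cite: Balaban1988Convergent, (2.7) p.255, (2.21) p.258, (2.35) p.261 (bookkeeping)] -/
theorem IsDatumOfRecord₁₃CSepCoPHOn.provisos (h : IsDatumOfRecord₁₃CSepCoPHOn F N Rg D) : h.params.Provisos₁₃SepCoPH F N :=
  (Classical.choose_spec h).fst

/-- **It lies IN THE REGIME.** [cite: Balaban1988Convergent, (3.16)–(3.22) pp.268–269 (bookkeeping)] -/
theorem IsDatumOfRecord₁₃CSepCoPHOn.regime (h : IsDatumOfRecord₁₃CSepCoPHOn F N Rg D) : Rg F h.params :=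
  (Classical.choose_spec h).snd.1

/-- Its admissibility. [cite: Balaban1987RG1, (1.12) p.262; Balaban1988Convergent, (2.10) p.256 (bookkeeping)] -/
theorem IsDatumOfRecord₁₃CSepCoPHOn.admissible (h : IsDatumOfRecord₁₃CSepCoPHOn F N Rg D) : h.params.Admissible F N :=
  (Classical.choose_spec h).snd.2.1

/-- **The datum IS the datum of record of its canonical parameter in the regime.** [cite: Balaban1989LargeFieldII, Thm 1 p.355 (bookkeeping)] -/
theorem IsDatumOfRecord₁₃CSepCoPHOn.eq_datumOfRecord₁₃SepCoPH (h : IsDatumOfRecord₁₃CSepCoPHOn F N Rg D) : D = datumOfRecord₁₃SepCoPH F N h.params h.provisos :=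
  (Classical.choose_spec h).snd.2.2

/-- The canonical parameter realises a C-datum key of `D` (pointed form; its `.params` is NOT asserted to be `h.params`). [cite: Balaban1989LargeFieldII, Thm 1 p.355 (bookkeeping)] -/
theorem IsDatumOfRecord₁₃CSepCoPHOn.isDatumOfRecord₁₃CSepCoPH_params (h : IsDatumOfRecord₁₃CSepCoPHOn F N Rg D) :
    IsDatumOfRecord₁₃CSepCoPH F N (datumOfRecord₁₃SepCoPH F N h.params h.provisos) :=
  isDatumOfRecord₁₃CSepCoPH_datumOfRecord₁₃SepCoPH F N h.params h.provisos h.admissible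

/-- The canonical parameter's coupling window is positive. [cite: Balaban1987RG1, (0.21) p.256 (bookkeeping)] -/
theorem IsDatumOfRecord₁₃CSepCoPHOn.gamma_pos (h : IsDatumOfRecord₁₃CSepCoPHOn F N Rg D) : 0 < h.params.γ :=
  h.admissible.toStage9.gamma_pos

/-- … and lies inside `]0, 1[`. [cite: Balaban1988Convergent, (2.28) p.259 (bookkeeping)] -/
theorem IsDatumOfRecord₁₃CSepCoPHOn.gamma_lt_one (h : IsDatumOfRecord₁₃CSepCoPHOn F N Rg D) : h.params.γ < 1 :=
  h.admissible.toStage12.pos₁₂.2.2.2.2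

/-- The canonical parameter in the regime depends on the datum only. [cite: Balaban1989LargeFieldII, Thm 1 + (0.1) pp.355–356 (bookkeeping)] -/
theorem IsDatumOfRecord₁₃CSepCoPHOn.params_congr {D' : FiniteEpsData F (SU N)} (h : IsDatumOfRecord₁₃CSepCoPHOn F N Rg D) (h' : IsDatumOfRecord₁₃CSepCoPHOn F N Rg D') (e : D = D') :
    h.params = h'.params := by
  subst e
  rfl

/-- **WHAT A CONSUMER PROVES IN THE REGIME ⟹ WHAT THE INSTANCE CARRIES**: a property of the objects of record established at EVERY admissible Stage-13 parameter tuple IN `Rg` with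
provisos holds at the canonical parameter in the regime of every datum of record in the regime — the regime is AVAILABLE as a hypothesis. [cite: Balaban1989LargeFieldII, Thm 1 p.355 (bookkeeping)] -/
theorem IsDatumOfRecord₁₃CSepCoPHOn.forall_params {P : (D : FiniteEpsData F (SU N)) → (θ : Stage13HParams F N) → θ.Provisos₁₃SepCoPH F N → Prop}
    (hP : ∀ (θ : Stage13HParams F N) (hθ : θ.Provisos₁₃SepCoPH F N), Rg F θ → θ.Admissible F N → P (datumOfRecord₁₃SepCoPH F N θ hθ) θ hθ) (h : IsDatumOfRecord₁₃CSepCoPHOn F N Rg D) :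
    P D h.params h.provisos := by
  have := hP h.params h.provisos h.regime h.admissible
  rwa [← h.eq_datumOfRecord₁₃SepCoPH] at this

/-- The datum's β-functions are the Stage-13 β of record at the canonical parameter. [cite: Balaban1987RG1, (1.20)–(1.22) p.264 (bookkeeping)] -/
theorem IsDatumOfRecord₁₃CSepCoPHOn.βfun_eq_betaOfRecord₁₃ (h : IsDatumOfRecord₁₃CSepCoPHOn F N Rg D) : D.βfun = betaOfRecord₁₃ F N h.params.toStage13Params := by
  have := βfun_datumOfRecord₁₃SepCoPH F N h.params h.provisos
  rwa [← h.eq_datumOfRecord₁₃SepCoPH] at this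

/-- The datum's coupling flow of the run `p` IS the Stage-13 generated history of record of the canonical parameter. [cite: Balaban1987RG1, (0.17)–(0.20) pp.255–256 (bookkeeping)] -/
theorem IsDatumOfRecord₁₃CSepCoPHOn.flow_g (h : IsDatumOfRecord₁₃CSepCoPHOn F N Rg D) (p : B12.RunParams) :
    (D.C p).flow.g = gOfRecord₁₃ F N h.params.toStage13Params p := by
  have := flow_g_datumOfRecord₁₃SepCoPH F N h.params h.provisos p
  rwa [← h.eq_datumOfRecord₁₃SepCoPH] at this

/-- A datum of record in the regime is a datum of record, Stage 0. [cite: Balaban1987RG1, (0.3)–(0.4) p.253 (bookkeeping)] -/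
theorem IsDatumOfRecord₁₃CSepCoPHOn.isDatumOfRecord₀ (h : IsDatumOfRecord₁₃CSepCoPHOn F N Rg D) : IsDatumOfRecord₀ F N D :=
  h.toC.isDatumOfRecord₀


end DatumKeyOn

/-! ## §5. «`(D, w)` is a Stage-13 record realised IN THE REGIME `Rg`»; world companions; the θ-keyed guarded junction -/

section RecordKeyOn

variable (F : T4Family) (N : ℕ) [NeZero N]

/-- **«`(D, w)` is a Stage-13 record (C-class) realised in the regime `Rg`»**: `IsRecordOfRecord₁₃CSepCoPH F N D w`'s body (the θ-exposed key `IsRateKey₁₃SepCoPH`) with the parameter IN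
`Rg` — the regime-restricted record class a guarded composer quantifies over (`Spine`, `S_R00x`, `S_N27x` at `fun F D w => IsRecordOfRecord₁₃CSepCoPHOn F N Rg D w`).  At `Rg := ⊤` it is
`IsRecordOfRecord₁₃CSepCoPH` (`isRecordOfRecord₁₃CSepCoPHOn_true_iff`). [cite: Balaban1989LargeFieldII, Thm 1 + (0.1) pp.355–356; Balaban1987RG1, (0.24)–(0.25) p.257 (objects of record; bookkeeping)] -/
def IsRecordOfRecord₁₃CSepCoPHOn (Rg : (F : T4Family) → Stage13HParams F N → Prop) (D : FiniteEpsData F (SU N)) (w : WorldP) : Prop :=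
  ∃ θ : Stage13HParams F N, Rg F θ ∧ IsRateKey₁₃SepCoPH F N D w θ

variable (Rg : (F : T4Family) → Stage13HParams F N → Prop)

/-- Unfolding (`Iff.rfl`). [cite: Balaban1989LargeFieldII, Thm 1 + (0.1) pp.355–356 (bookkeeping)] -/
theorem isRecordOfRecord₁₃CSepCoPHOn_iff (D : FiniteEpsData F (SU N)) (w : WorldP) :
    IsRecordOfRecord₁₃CSepCoPHOn F N Rg D w ↔ ∃ θ : Stage13HParams F N, Rg F θ ∧ IsRateKey₁₃SepCoPH F N D w θ :=
  Iff.rfl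

/-- **Every admissible θ in the regime with provisos is a record in the regime at some world with any window `0 < γw ≤ θ.γ`.** [cite: Balaban1989LargeFieldII, Thm 1 + (0.1) pp.355–356 (bookkeeping)] -/
theorem exists_world_isRecordOfRecord₁₃CSepCoPHOn (θ : Stage13HParams F N) (h : θ.Provisos₁₃SepCoPH F N) (hRg : Rg F θ) (hθ : θ.Admissible F N) {γw : ℝ}
    (hγw : 0 < γw ∧ γw ≤ θ.γ) : ∃ w : WorldP, IsRecordOfRecord₁₃CSepCoPHOn F N Rg (datumOfRecord₁₃SepCoPH F N θ h) w ∧ w.γ = γw := by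
  obtain ⟨w, hk, hγ⟩ := exists_world_isRateKey₁₃SepCoPH F N θ h hθ hγw
  exact ⟨w, ⟨θ, hRg, hk⟩, hγ⟩

/-- Some datum of record in the regime exists iff some record in the regime exists. [cite: Balaban1989LargeFieldII, Thm 1 + (0.1) pp.355–356 (bookkeeping)] -/
theorem exists_isDatumOfRecord₁₃CSepCoPHOn_iff_exists_record :
    (∃ D : FiniteEpsData F (SU N), IsDatumOfRecord₁₃CSepCoPHOn F N Rg D) ↔ ∃ (D : FiniteEpsData F (SU N)) (w : WorldP), IsRecordOfRecord₁₃CSepCoPHOn F N Rg D w := by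
  constructor
  · rintro ⟨_, θ, hP, hRg, hθ, rfl⟩
    obtain ⟨w, hw, -⟩ := exists_world_isRecordOfRecord₁₃CSepCoPHOn F N Rg θ hP hRg hθ ⟨hθ.toStage9.gamma_pos, le_rfl⟩
    exact ⟨_, w, hw⟩
  · rintro ⟨D, w, θ, hRg, hk⟩
    obtain ⟨hP, hθ, hD⟩ := hk.exists_provisos
    exact ⟨D, θ, hP, hRg, hθ, hD⟩

/-- **A WORLD-BLIND PROPERTY AT EVERY RECORD IN THE REGIME ⟺ THE θ-KEYED SENTENCE GUARDED BY `Rg`** — the junction between a composer's conclusion over the regime-restricted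
record class (e.g. `YMDAG.UVSplit.Spine` at `IsRecordOfRecord₁₃CSepCoPHOn F N Rg`) and an item text «`∀ θ (h : θ.Provisos₁₃SepCoPH F N), Rg F θ → θ.Admissible F N → P (datumOfRecord₁₃SepCoPH F N θ h)`».
[cite: Balaban1989LargeFieldII, Thm 1 + (0.1) pp.355–356 (bookkeeping)] -/
theorem forall_isRecordOfRecord₁₃CSepCoPHOn_iff (P : FiniteEpsData F (SU N) → Prop) :
    (∀ (D : FiniteEpsData F (SU N)) (w : WorldP), IsRecordOfRecord₁₃CSepCoPHOn F N Rg D w → P D) ↔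
      ∀ (θ : Stage13HParams F N) (h : θ.Provisos₁₃SepCoPH F N), Rg F θ → θ.Admissible F N → P (datumOfRecord₁₃SepCoPH F N θ h) := by
  constructor
  · intro hall θ h hRg hθ
    obtain ⟨w, hw, -⟩ := exists_world_isRecordOfRecord₁₃CSepCoPHOn F N Rg θ h hRg hθ ⟨hθ.toStage9.gamma_pos, le_rfl⟩
    exact hall _ w hw
  · rintro hall D w ⟨θ, hRg, hk⟩
    obtain ⟨h, hθ, rfl⟩ := hk.exists_provisos
    exact hall θ h hRg hθ

variable {F N Rg}
variable {D : FiniteEpsData F (SU N)} {w : WorldP}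

/-- The regime forgotten: a record in the regime is a Stage-13 record. [cite: Balaban1989LargeFieldII, Thm 1 p.355 (bookkeeping)] -/
theorem IsRecordOfRecord₁₃CSepCoPHOn.isRecordOfRecord₁₃CSepCoPH (h : IsRecordOfRecord₁₃CSepCoPHOn F N Rg D w) : IsRecordOfRecord₁₃CSepCoPH F N D w := by
  obtain ⟨θ, -, hk⟩ := h
  exact hk.isRecordOfRecord₁₃CSepCoPH

/-- Its datum is a datum of record in the regime. [cite: Balaban1989LargeFieldII, Thm 1 p.355 (bookkeeping)] -/
theorem IsRecordOfRecord₁₃CSepCoPHOn.isDatumOfRecord₁₃CSepCoPHOn (h : IsRecordOfRecord₁₃CSepCoPHOn F N Rg D w) : IsDatumOfRecord₁₃CSepCoPHOn F N Rg D := by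
  obtain ⟨θ, hRg, hk⟩ := h
  obtain ⟨hP, hθ, hD⟩ := hk.exists_provisos
  exact ⟨θ, hP, hRg, hθ, hD⟩

/-- **THE TUPLE IN THE REGIME BEHIND A RECORD IN THE REGIME** — exactly the hypothesis shape of the (T-RATE) home's `s_R00x_rRec₁₂On_of_regime` (to be re-keyed at ₁₃) («every record of `Rec` comes with
an admissible tuple with provisos in the regime realising `D`»): ONE application. [cite: Balaban1989LargeFieldII, Thm 1 + (0.1) pp.355–356 (bookkeeping)] -/
theorem IsRecordOfRecord₁₃CSepCoPHOn.exists_regime_tuple (h : IsRecordOfRecord₁₃CSepCoPHOn F N Rg D w) :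
    ∃ (θ : Stage13HParams F N) (hP : θ.Provisos₁₃SepCoPH F N), Rg F θ ∧ θ.Admissible F N ∧ D = datumOfRecord₁₃SepCoPH F N θ hP :=
  h.isDatumOfRecord₁₃CSepCoPHOn

/-- Monotone in the regime. [cite: Balaban1989LargeFieldII, Thm 1 p.355 (bookkeeping)] -/
theorem IsRecordOfRecord₁₃CSepCoPHOn.mono {Rg' : (F : T4Family) → Stage13HParams F N → Prop} (hle : ∀ (F : T4Family) (θ : Stage13HParams F N), Rg F θ → Rg' F θ)
    (h : IsRecordOfRecord₁₃CSepCoPHOn F N Rg D w) : IsRecordOfRecord₁₃CSepCoPHOn F N Rg' D w := by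
  obtain ⟨θ, hRg, hk⟩ := h
  exact ⟨θ, hle F θ hRg, hk⟩

/-- The world's window is positive. [cite: Balaban1987RG1, Thm 1 p.259 (bookkeeping)] -/
theorem IsRecordOfRecord₁₃CSepCoPHOn.gamma_pos (h : IsRecordOfRecord₁₃CSepCoPHOn F N Rg D w) : 0 < w.γ := by
  obtain ⟨θ, -, hk⟩ := h
  exact hk.gamma_pos

/-- The world is bound to the datum's construction. [cite: Balaban1989LargeFieldII, Thm 1 + (0.1) pp.355–356 (bookkeeping)] -/
theorem IsRecordOfRecord₁₃CSepCoPHOn.construction_eq (h : IsRecordOfRecord₁₃CSepCoPHOn F N Rg D w) : w.C = D.C := by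
  obtain ⟨θ, -, hk⟩ := h
  exact hk.construction_eq

/-- A Stage-13 record keyed at a θ IN THE REGIME is a record in the regime (pointed intro). [cite: Balaban1989LargeFieldII, Thm 1 + (0.1) pp.355–356 (bookkeeping)] -/
theorem IsRateKey₁₃SepCoPH.isRecordOfRecord₁₃CSepCoPHOn {θ : Stage13HParams F N} (hk : IsRateKey₁₃SepCoPH F N D w θ) (hRg : Rg F θ) : IsRecordOfRecord₁₃CSepCoPHOn F N Rg D w :=
  ⟨θ, hRg, hk⟩

/-- At the trivial regime the record key IS `IsRecordOfRecord₁₃CSepCoPH`. [cite: Balaban1989LargeFieldII, Thm 1 p.355 (bookkeeping)] -/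
theorem isRecordOfRecord₁₃CSepCoPHOn_true_iff : IsRecordOfRecord₁₃CSepCoPHOn F N (fun _ _ => True) D w ↔ IsRecordOfRecord₁₃CSepCoPH F N D w :=
  ⟨fun h => h.isRecordOfRecord₁₃CSepCoPH, fun ⟨θ, hk⟩ => ⟨θ, trivial, hk⟩⟩

/-- **DATUM OF RECORD IN THE REGIME ⟺ RECORD IN THE REGIME AT SOME WORLD.** [cite: Balaban1989LargeFieldII, Thm 1 + (0.1) pp.355–356 (bookkeeping)] -/
theorem isDatumOfRecord₁₃CSepCoPHOn_iff_exists_world : IsDatumOfRecord₁₃CSepCoPHOn F N Rg D ↔ ∃ w : WorldP, IsRecordOfRecord₁₃CSepCoPHOn F N Rg D w := by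
  constructor
  · rintro ⟨θ, hP, hRg, hθ, rfl⟩
    obtain ⟨w, hw, -⟩ := exists_world_isRecordOfRecord₁₃CSepCoPHOn F N Rg θ hP hRg hθ ⟨hθ.toStage9.gamma_pos, le_rfl⟩
    exact ⟨w, hw⟩
  · rintro ⟨w, hw⟩
    exact hw.isDatumOfRecord₁₃CSepCoPHOn

/-- **WORLD COMPANION IN THE REGIME AT ANY WINDOW BELOW THE CANONICAL ONE** (what an N17-type home-keying binder consumes once the U3 radius is pinned in `]0, h.params.γ]`).
[cite: Balaban1989LargeFieldII, Thm 1 + (0.1) pp.355–356 (bookkeeping)] -/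
theorem IsDatumOfRecord₁₃CSepCoPHOn.exists_world (h : IsDatumOfRecord₁₃CSepCoPHOn F N Rg D) {γw : ℝ} (hγw : 0 < γw ∧ γw ≤ h.params.γ) :
    ∃ w : WorldP, IsRecordOfRecord₁₃CSepCoPHOn F N Rg D w ∧ w.γ = γw := by
  obtain ⟨w, hw, hγ⟩ := exists_world_isRecordOfRecord₁₃CSepCoPHOn F N Rg h.params h.provisos h.regime h.admissible hγw
  exact ⟨w, h.eq_datumOfRecord₁₃SepCoPH ▸ hw, hγ⟩

/-- … in particular at the canonical window itself. [cite: Balaban1989LargeFieldII, Thm 1 + (0.1) pp.355–356 (bookkeeping)] -/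
theorem IsDatumOfRecord₁₃CSepCoPHOn.exists_world_gamma (h : IsDatumOfRecord₁₃CSepCoPHOn F N Rg D) :
    ∃ w : WorldP, IsRecordOfRecord₁₃CSepCoPHOn F N Rg D w ∧ w.γ = h.params.γ :=
  h.exists_world ⟨h.gamma_pos, le_rfl⟩

/-- The ₅C shadow at the canonical parameter in the regime (for consumers keyed at ₅C). [cite: Balaban1989LargeFieldII, Thm 1 + (0.1) pp.355–356 (bookkeeping)] -/
theorem IsDatumOfRecord₁₃CSepCoPHOn.exists_isRecordOfRecord₅C (h : IsDatumOfRecord₁₃CSepCoPHOn F N Rg D) :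
    ∃ (D₅ : FiniteEpsData F (SU N)) (w : WorldP), IsRecordOfRecord₅C F N D₅ w ∧ D₅.C = D.C ∧ (∀ K g₀ k, D₅.dens K g₀ k = D.dens K g₀ k) ∧
      D₅.βfun = D.βfun ∧ D₅.av = D.av :=
  h.toC.exists_isRecordOfRecord₅C

end RecordKeyOn

/-! ## §6. Canonicalised readings RELATIVE TO THE REGIME — coherence for regime homes keyed «`∃ θ hP, Rg F θ ∧ θ.Admissible F N ∧ D = datumOfRecord₁₃SepCoPH F N θ hP ∧ S = cr F θ hP …`»

As `canon₁₃SepCoPH` (gen 2) for the C key: reading a regime-keyed record through `canon₁₃SepCoPHOn Rg f` makes the admitted bundle a function of the DATUM, read at the canonical parameter IN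
THE REGIME, so two regime homes read through `canon₁₃SepCoPHOn Rg` admit, at the same `(F, D, g₀, os)`, bundles read at ONE parameter (`exists_keyed_canon₁₃SepCoPHOn_iff`,
`keyed_canon₁₃SepCoPHOn_coherent`).  Off the class `canon₁₃SepCoPHOn Rg f = f`. -/
section CanonOn

variable (F : T4Family) (N : ℕ) [NeZero N] (Rg : (F : T4Family) → Stage13HParams F N → Prop) {α : Sort*}

/-- **CANONICALISED READING RELATIVE TO THE REGIME**: read `f` at the canonical parameter in `Rg` of the datum `datumOfRecord₁₃SepCoPH F N θ hP` when that datum is of record in the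
regime, else at `(θ, hP)` itself.  Kernel bookkeeping (`Classical.dec`, `dite`). [cite: Balaban1989LargeFieldII, Thm 1 + (0.1) pp.355–356 (bookkeeping)] -/
def canon₁₃SepCoPHOn (f : (θ : Stage13HParams F N) → θ.Provisos₁₃SepCoPH F N → α) (θ : Stage13HParams F N) (hP : θ.Provisos₁₃SepCoPH F N) : α := by
  classical
  exact if h : IsDatumOfRecord₁₃CSepCoPHOn F N Rg (datumOfRecord₁₃SepCoPH F N θ hP) then f h.params h.provisos else f θ hP

variable {F N Rg}

/-- **`canon₁₃SepCoPHOn Rg f θ hP = f h.params h.provisos`** whenever `(θ, hP)` realises a datum of record in the regime `D` with key `h`. [cite: Balaban1989LargeFieldII, Thm 1 + (0.1) pp.355–356 (bookkeeping)] -/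
theorem canon₁₃SepCoPHOn_eq_of_eq {f : (θ : Stage13HParams F N) → θ.Provisos₁₃SepCoPH F N → α} {D : FiniteEpsData F (SU N)} (h : IsDatumOfRecord₁₃CSepCoPHOn F N Rg D)
    (θ : Stage13HParams F N) (hP : θ.Provisos₁₃SepCoPH F N) (e : D = datumOfRecord₁₃SepCoPH F N θ hP) :
    canon₁₃SepCoPHOn F N Rg f θ hP = f h.params h.provisos := by
  subst e
  unfold canon₁₃SepCoPHOn
  rw [dif_pos h]

/-- At the canonical parameter in the regime `canon₁₃SepCoPHOn Rg f` reads `f`. [cite: Balaban1989LargeFieldII, Thm 1 + (0.1) pp.355–356 (bookkeeping)] -/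
theorem canon₁₃SepCoPHOn_params {f : (θ : Stage13HParams F N) → θ.Provisos₁₃SepCoPH F N → α} {D : FiniteEpsData F (SU N)} (h : IsDatumOfRecord₁₃CSepCoPHOn F N Rg D) :
    canon₁₃SepCoPHOn F N Rg f h.params h.provisos = f h.params h.provisos :=
  canon₁₃SepCoPHOn_eq_of_eq h h.params h.provisos h.eq_datumOfRecord₁₃SepCoPH

/-- At an admissible tuple IN THE REGIME with provisos, `canon₁₃SepCoPHOn Rg f` reads `f` at the canonical parameter in the regime of ITS datum. [cite: Balaban1989LargeFieldII, Thm 1 + (0.1) pp.355–356 (bookkeeping)] -/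
theorem canon₁₃SepCoPHOn_eq_of_regime {f : (θ : Stage13HParams F N) → θ.Provisos₁₃SepCoPH F N → α} (θ : Stage13HParams F N) (hP : θ.Provisos₁₃SepCoPH F N) (hRg : Rg F θ)
    (hθ : θ.Admissible F N) :
    canon₁₃SepCoPHOn F N Rg f θ hP = f (isDatumOfRecord₁₃CSepCoPHOn_datumOfRecord₁₃SepCoPH F N Rg θ hP hRg hθ).params (isDatumOfRecord₁₃CSepCoPHOn_datumOfRecord₁₃SepCoPH F N Rg θ hP hRg hθ).provisos :=
  canon₁₃SepCoPHOn_eq_of_eq _ θ hP rfl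

/-- Off the class nothing is canonicalised. [cite: Balaban1989LargeFieldII, Thm 1 + (0.1) pp.355–356 (bookkeeping)] -/
theorem canon₁₃SepCoPHOn_eq_self_of_not {f : (θ : Stage13HParams F N) → θ.Provisos₁₃SepCoPH F N → α} (θ : Stage13HParams F N) (hP : θ.Provisos₁₃SepCoPH F N)
    (hn : ¬ IsDatumOfRecord₁₃CSepCoPHOn F N Rg (datumOfRecord₁₃SepCoPH F N θ hP)) : canon₁₃SepCoPHOn F N Rg f θ hP = f θ hP := by
  unfold canon₁₃SepCoPHOn
  rw [dif_neg hn]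

/-- **THE KEYED-RECORD FACE, IN THE REGIME**: a regime-keyed record read through `canon₁₃SepCoPHOn Rg f` IS the datum-keyed record «the bundle reads `f` at the canonical parameter in
the regime of `D`», for every property `Φ` of the reading. [cite: Balaban1989LargeFieldII, Thm 1 + (0.1) pp.355–356 (bookkeeping)] -/
theorem exists_keyed_canon₁₃SepCoPHOn_iff {f : (θ : Stage13HParams F N) → θ.Provisos₁₃SepCoPH F N → α} {D : FiniteEpsData F (SU N)} (Φ : α → Prop) :
    (∃ (θ : Stage13HParams F N) (hP : θ.Provisos₁₃SepCoPH F N), Rg F θ ∧ θ.Admissible F N ∧ D = datumOfRecord₁₃SepCoPH F N θ hP ∧ Φ (canon₁₃SepCoPHOn F N Rg f θ hP)) ↔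
      ∃ h : IsDatumOfRecord₁₃CSepCoPHOn F N Rg D, Φ (f h.params h.provisos) := by
  constructor
  · rintro ⟨θ, hP, hRg, hθ, e, hΦ⟩
    have h : IsDatumOfRecord₁₃CSepCoPHOn F N Rg D := ⟨θ, hP, hRg, hθ, e⟩
    refine ⟨h, ?_⟩
    rwa [canon₁₃SepCoPHOn_eq_of_eq (f := f) h θ hP e] at hΦ
  · rintro ⟨h, hΦ⟩
    refine ⟨h.params, h.provisos, h.regime, h.admissible, h.eq_datumOfRecord₁₃SepCoPH, ?_⟩
    rwa [canon₁₃SepCoPHOn_params (f := f) h]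

/-- **COHERENCE IN THE REGIME**: two regime-keyed records read through `canon₁₃SepCoPHOn Rg` admit, at the same datum, readings AT THE SAME PARAMETER.
[cite: Balaban1989LargeFieldII, Thm 1 + (0.1) pp.355–356 (bookkeeping)] -/
theorem keyed_canon₁₃SepCoPHOn_coherent {β : Sort*} {f : (θ : Stage13HParams F N) → θ.Provisos₁₃SepCoPH F N → α} {g : (θ : Stage13HParams F N) → θ.Provisos₁₃SepCoPH F N → β}
    {D : FiniteEpsData F (SU N)} (Φ : α → Prop) (Ψ : β → Prop)
    (hΦ : ∃ (θ : Stage13HParams F N) (hP : θ.Provisos₁₃SepCoPH F N), Rg F θ ∧ θ.Admissible F N ∧ D = datumOfRecord₁₃SepCoPH F N θ hP ∧ Φ (canon₁₃SepCoPHOn F N Rg f θ hP))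
    (hΨ : ∃ (θ : Stage13HParams F N) (hP : θ.Provisos₁₃SepCoPH F N), Rg F θ ∧ θ.Admissible F N ∧ D = datumOfRecord₁₃SepCoPH F N θ hP ∧ Ψ (canon₁₃SepCoPHOn F N Rg g θ hP)) :
    ∃ h : IsDatumOfRecord₁₃CSepCoPHOn F N Rg D, Φ (f h.params h.provisos) ∧ Ψ (g h.params h.provisos) := by
  obtain ⟨h, h₁⟩ := (exists_keyed_canon₁₃SepCoPHOn_iff Φ).1 hΦ
  obtain ⟨h', h₂⟩ := (exists_keyed_canon₁₃SepCoPHOn_iff Ψ).1 hΨ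
  exact ⟨h, h₁, h₂⟩

end CanonOn

/-! ## §7. THE GUARD OF RECORD «partition of unity ∧ non-degenerate present slots» and the CN instances

The route's Stage-13 items (rev 16, to be minted) bundle `θ.ZhUnity F N` (print's partition of unity for the residual 𝐓-weights, [Balaban1988Convergent] (3.16)–(3.20)) and
`θ.SlotsNondegenerate₁₃ F N` (no present slot of record is the zero density, (3.22)) into ONE conjunction on the datum's own parameter.  Named once as a regime; the «CN key» is
§4–§6 at that regime. -/

section Guard

variable (F : T4Family) (N : ℕ) [NeZero N]


/-- **THE CN KEY — «`D` is a datum of record, Stage 13, realised by an admissible tuple WITH print's partition of unity AND non-degenerate present slots»**: the datum key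
at the guard of record. [cite: Balaban1989LargeFieldII, Thm 1 + (0.1) pp.355–356; Balaban1988Convergent, (3.16)–(3.22) pp.268–269 (objects of record; bookkeeping)] -/
abbrev IsDatumOfRecord₁₃CSepCoPHN (D : FiniteEpsData F (SU N)) : Prop :=
  IsDatumOfRecord₁₃CSepCoPHOn F N (unityNondeg₁₃H N) D

/-- **THE CN RECORD CLASS** at the guard of record. [cite: Balaban1989LargeFieldII, Thm 1 + (0.1) pp.355–356; Balaban1988Convergent, (3.16)–(3.22) pp.268–269 (objects of record; bookkeeping)] -/
abbrev IsRecordOfRecord₁₃CSepCoPHN (D : FiniteEpsData F (SU N)) (w : WorldP) : Prop :=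
  IsRecordOfRecord₁₃CSepCoPHOn F N (unityNondeg₁₃H N) D w

/-- **The CN key, literally**: SOME Stage-13 parameter tuple with provisos, `(θ.ZhUnity F N ∧ θ.SlotsNondegenerate₁₃ F N)`, admissible, has `D` as its datum of record (`Iff.rfl`).
[cite: Balaban1989LargeFieldII, Thm 1 + (0.1) pp.355–356; Balaban1988Convergent, (3.16)–(3.22) pp.268–269 (bookkeeping)] -/
theorem isDatumOfRecord₁₃CSepCoPHN_iff (D : FiniteEpsData F (SU N)) :
    IsDatumOfRecord₁₃CSepCoPHN F N D ↔
      ∃ (θ : Stage13HParams F N) (h : θ.Provisos₁₃SepCoPH F N), (θ.ZhUnity F N ∧ θ.SlotsNondegenerate₁₃ F N) ∧ θ.Admissible F N ∧ D = datumOfRecord₁₃SepCoPH F N θ h :=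
  Iff.rfl

/-- **The CN record class, literally** (`Iff.rfl`). [cite: Balaban1989LargeFieldII, Thm 1 + (0.1) pp.355–356 (bookkeeping)] -/
theorem isRecordOfRecord₁₃CSepCoPHN_iff (D : FiniteEpsData F (SU N)) (w : WorldP) :
    IsRecordOfRecord₁₃CSepCoPHN F N D w ↔ ∃ θ : Stage13HParams F N, (θ.ZhUnity F N ∧ θ.SlotsNondegenerate₁₃ F N) ∧ IsRateKey₁₃SepCoPH F N D w θ :=
  Iff.rfl

/-- Intro at a guarded admissible tuple with provisos. [cite: Balaban1989LargeFieldII, Thm 1 + (0.1) pp.355–356 (bookkeeping)] -/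
theorem isDatumOfRecord₁₃CSepCoPHN_datumOfRecord₁₃SepCoPH (θ : Stage13HParams F N) (h : θ.Provisos₁₃SepCoPH F N) (hG : θ.ZhUnity F N ∧ θ.SlotsNondegenerate₁₃ F N) (hθ : θ.Admissible F N) :
    IsDatumOfRecord₁₃CSepCoPHN F N (datumOfRecord₁₃SepCoPH F N θ h) :=
  isDatumOfRecord₁₃CSepCoPHOn_datumOfRecord₁₃SepCoPH F N _ θ h hG hθ

/-- **K0′ READS THE SAME AT THE CN DATUM**: some CN datum of record exists at `(F, N)` iff SOME Stage-13 parameter tuple satisfies every displayed proviso, print's partition of unity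
and non-degeneracy of the present slots, and is admissible — the body of the route's `Record12Inhabited` (rev 15) at `(F, N)`, verbatim; inhabitation is NOT claimed here.
[cite: Balaban1988Convergent, (2.7) p.255, (2.21) p.258, (2.28) p.259, (3.16)–(3.22) pp.268–269; Balaban1987RG1, (1.12)–(1.15) p.262 (hypothesis dictionary; bookkeeping)] -/
theorem exists_isDatumOfRecord₁₃CSepCoPHN_iff_exists_params :
    (∃ D : FiniteEpsData F (SU N), IsDatumOfRecord₁₃CSepCoPHN F N D) ↔
      ∃ θ : Stage13HParams F N, θ.Provisos₁₃SepCoPH F N ∧ (θ.ZhUnity F N ∧ θ.SlotsNondegenerate₁₃ F N) ∧ θ.Admissible F N :=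
  exists_isDatumOfRecord₁₃CSepCoPHOn_iff_exists_params F N _

/-- … and iff some CN record exists. [cite: Balaban1989LargeFieldII, Thm 1 + (0.1) pp.355–356 (bookkeeping)] -/
theorem exists_isRecordOfRecord₁₃CSepCoPHN_iff_exists_params :
    (∃ (D : FiniteEpsData F (SU N)) (w : WorldP), IsRecordOfRecord₁₃CSepCoPHN F N D w) ↔
      ∃ θ : Stage13HParams F N, θ.Provisos₁₃SepCoPH F N ∧ (θ.ZhUnity F N ∧ θ.SlotsNondegenerate₁₃ F N) ∧ θ.Admissible F N :=
  (exists_isDatumOfRecord₁₃CSepCoPHOn_iff_exists_record F N _).symm.trans (exists_isDatumOfRecord₁₃CSepCoPHN_iff_exists_params F N)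

/-- **THE K2′ ∕ K3′ JUNCTION**: a world-blind property at EVERY CN record ⟺ the θ-keyed sentence «`∀ θ (h : θ.Provisos₁₃SepCoPH F N), (θ.ZhUnity F N ∧ θ.SlotsNondegenerate₁₃ F N) →
θ.Admissible F N → P (datumOfRecord₁₃SepCoPH F N θ h)`» — the items' binder prefix (what a `Spine` ∕ endpoint composer over the CN record class reads the text off).
[cite: Balaban1989LargeFieldII, Thm 1 + (0.1) pp.355–356 (bookkeeping)] -/
theorem forall_isRecordOfRecord₁₃CSepCoPHN_iff (P : FiniteEpsData F (SU N) → Prop) :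
    (∀ (D : FiniteEpsData F (SU N)) (w : WorldP), IsRecordOfRecord₁₃CSepCoPHN F N D w → P D) ↔
      ∀ (θ : Stage13HParams F N) (h : θ.Provisos₁₃SepCoPH F N), (θ.ZhUnity F N ∧ θ.SlotsNondegenerate₁₃ F N) → θ.Admissible F N → P (datumOfRecord₁₃SepCoPH F N θ h) :=
  forall_isRecordOfRecord₁₃CSepCoPHOn_iff F N _ P

/-- … datum-level form. [cite: Balaban1989LargeFieldII, Thm 1 + (0.1) pp.355–356 (bookkeeping)] -/
theorem forall_isDatumOfRecord₁₃CSepCoPHN_iff (P : FiniteEpsData F (SU N) → Prop) :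
    (∀ D : FiniteEpsData F (SU N), IsDatumOfRecord₁₃CSepCoPHN F N D → P D) ↔
      ∀ (θ : Stage13HParams F N) (h : θ.Provisos₁₃SepCoPH F N), (θ.ZhUnity F N ∧ θ.SlotsNondegenerate₁₃ F N) → θ.Admissible F N → P (datumOfRecord₁₃SepCoPH F N θ h) :=
  forall_isDatumOfRecord₁₃CSepCoPHOn_iff F N _ P

/-- Every guarded admissible θ with provisos is a CN record at some world with any window `0 < γw ≤ θ.γ`. [cite: Balaban1989LargeFieldII, Thm 1 + (0.1) pp.355–356 (bookkeeping)] -/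
theorem exists_world_isRecordOfRecord₁₃CSepCoPHN (θ : Stage13HParams F N) (h : θ.Provisos₁₃SepCoPH F N) (hG : θ.ZhUnity F N ∧ θ.SlotsNondegenerate₁₃ F N) (hθ : θ.Admissible F N)
    {γw : ℝ} (hγw : 0 < γw ∧ γw ≤ θ.γ) : ∃ w : WorldP, IsRecordOfRecord₁₃CSepCoPHN F N (datumOfRecord₁₃SepCoPH F N θ h) w ∧ w.γ = γw :=
  exists_world_isRecordOfRecord₁₃CSepCoPHOn F N _ θ h hG hθ hγw

variable {F N}
variable {D : FiniteEpsData F (SU N)} {w : WorldP}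

/-- **THE GUARD AT THE CANONICAL CN PARAMETER** — the one thing the C key cannot supply. [cite: Balaban1988Convergent, (3.16)–(3.22) pp.268–269 (bookkeeping)] -/
theorem IsDatumOfRecord₁₃CSepCoPHN.guard (h : IsDatumOfRecord₁₃CSepCoPHN F N D) : h.params.ZhUnity F N ∧ h.params.SlotsNondegenerate₁₃ F N :=
  h.regime

/-- Print's partition of unity at the canonical CN parameter. [cite: Balaban1988Convergent, (3.16)–(3.20) pp.268–269 (bookkeeping)] -/
theorem IsDatumOfRecord₁₃CSepCoPHN.zhUnity (h : IsDatumOfRecord₁₃CSepCoPHN F N D) : h.params.ZhUnity F N :=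
  h.regime.1

/-- Non-degeneracy of the present slots at the canonical CN parameter. [cite: Balaban1988Convergent, (3.22) p.269 (bookkeeping)] -/
theorem IsDatumOfRecord₁₃CSepCoPHN.slotsNondegenerate (h : IsDatumOfRecord₁₃CSepCoPHN F N D) : h.params.SlotsNondegenerate₁₃ F N :=
  h.regime.2

/-- **WHAT A CONSUMER PROVES UNDER THE GUARD ⟹ WHAT THE CN INSTANCE CARRIES** (the items' binder order: guard, then admissibility). [cite: Balaban1989LargeFieldII, Thm 1 p.355 (bookkeeping)] -/
theorem IsDatumOfRecord₁₃CSepCoPHN.forall_params {P : (D : FiniteEpsData F (SU N)) → (θ : Stage13HParams F N) → θ.Provisos₁₃SepCoPH F N → Prop}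
    (hP : ∀ (θ : Stage13HParams F N) (hθ : θ.Provisos₁₃SepCoPH F N), (θ.ZhUnity F N ∧ θ.SlotsNondegenerate₁₃ F N) → θ.Admissible F N → P (datumOfRecord₁₃SepCoPH F N θ hθ) θ hθ)
    (h : IsDatumOfRecord₁₃CSepCoPHN F N D) : P D h.params h.provisos :=
  IsDatumOfRecord₁₃CSepCoPHOn.forall_params hP h

/-- A CN datum is a C datum (the guard forgotten; its C-canonical parameter is NOT asserted to satisfy the guard). [cite: Balaban1989LargeFieldII, Thm 1 p.355 (bookkeeping)] -/
theorem IsDatumOfRecord₁₃CSepCoPHN.isDatumOfRecord₁₃CSepCoPH (h : IsDatumOfRecord₁₃CSepCoPHN F N D) : IsDatumOfRecord₁₃CSepCoPH F N D :=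
  h.toC

/-- A CN record is a Stage-13 record. [cite: Balaban1989LargeFieldII, Thm 1 p.355 (bookkeeping)] -/
theorem IsRecordOfRecord₁₃CSepCoPHN.isRecordOfRecord₁₃CSepCoPH' (h : IsRecordOfRecord₁₃CSepCoPHN F N D w) : IsRecordOfRecord₁₃CSepCoPH F N D w :=
  h.isRecordOfRecord₁₃CSepCoPH

/-- The guarded tuple behind a CN record (feeds the ₁₃ re-key of `s_R00x_rRec₁₂On_of_regime 𝔯 ·` at `unityNondeg₁₃H N` in one application). [cite: Balaban1989LargeFieldII, Thm 1 + (0.1) pp.355–356 (bookkeeping)] -/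
theorem IsRecordOfRecord₁₃CSepCoPHN.exists_guarded_tuple (h : IsRecordOfRecord₁₃CSepCoPHN F N D w) :
    ∃ (θ : Stage13HParams F N) (hP : θ.Provisos₁₃SepCoPH F N), (θ.ZhUnity F N ∧ θ.SlotsNondegenerate₁₃ F N) ∧ θ.Admissible F N ∧ D = datumOfRecord₁₃SepCoPH F N θ hP :=
  h.exists_regime_tuple

/-- A datum of record whose C-canonical parameter satisfies the guard is a CN datum. [cite: Balaban1989LargeFieldII, Thm 1 p.355 (bookkeeping)] -/
theorem IsDatumOfRecord₁₃CSepCoPH.isDatumOfRecord₁₃CSepCoPHN_of_guard (h : IsDatumOfRecord₁₃CSepCoPH F N D) (hG : h.params.ZhUnity F N ∧ h.params.SlotsNondegenerate₁₃ F N) :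
    IsDatumOfRecord₁₃CSepCoPHN F N D :=
  h.isDatumOfRecord₁₃CSepCoPHOn_of_regime_params hG

end Guard

/-! ## §8. THE ONE-WAY BRIDGE INTO THE `CoPH` KEYS (`Node00/Record13DatumKeyCoPH`, provisos `Provisos₁₃CoPH`): by def-T's `Stage13HParams.Provisos₁₃SepCoPH.toCore` and the
definitional agreement of the two data of record (def-T's `datumOfRecord₁₃SepCoPH_eq_coPH`, `rfl`), every datum ∕ record keyed on the provisos of this module (`Provisos₁₃SepCoPH`) is keyed on `Provisos₁₃CoPH`
AT THE SAME DATUM AND PARAMETER; NOT conversely (a `CoPH` record asserts no background-field bound), and there is NO bridge to or from the ‴ ∕ ⁗ ∕ `SepMixed` keys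
(their data read another background object). -/

section BridgeToCoPH

variable {F : T4Family} {N : ℕ} [NeZero N]
variable {D : FiniteEpsData F (SU N)} {w : WorldP} {Rg : (F : T4Family) → Stage13HParams F N → Prop} {θ : Stage13HParams F N}

/-- The θ-exposed `SepCoPH` key gives the `CoPH` one (same θ). [cite: Balaban1989LargeFieldII, Thm 1 + (0.1) pp.355–356 (bookkeeping)] -/
theorem IsRateKey₁₃SepCoPH.toCoPH (h : IsRateKey₁₃SepCoPH F N D w θ) : IsRateKey₁₃CoPH F N D w θ := by
  obtain ⟨hP, hθ, hD, hrest⟩ := h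
  exact ⟨hP.toCore, hθ, hD, hrest⟩

/-- A `SepCoPH`-keyed datum of record is a `CoPH`-keyed datum of record. [cite: Balaban1989LargeFieldII, Thm 1 + (0.1) pp.355–356 (bookkeeping)] -/
theorem IsDatumOfRecord₁₃CSepCoPH.toCoPH (h : IsDatumOfRecord₁₃CSepCoPH F N D) : IsDatumOfRecord₁₃CCoPH F N D := by
  obtain ⟨θ, hP, hθ, hD⟩ := h
  exact ⟨θ, hP.toCore, hθ, hD⟩

/-- … in every regime. [cite: Balaban1989LargeFieldII, Thm 1 + (0.1) pp.355–356 (bookkeeping)] -/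
theorem IsDatumOfRecord₁₃CSepCoPHOn.toCoPH (h : IsDatumOfRecord₁₃CSepCoPHOn F N Rg D) : IsDatumOfRecord₁₃CCoPHOn F N Rg D := by
  obtain ⟨θ, hP, hR, hθ, hD⟩ := h
  exact ⟨θ, hP.toCore, hR, hθ, hD⟩

/-- … and for records in every regime. [cite: Balaban1989LargeFieldII, Thm 1 + (0.1) pp.355–356 (bookkeeping)] -/
theorem IsRecordOfRecord₁₃CSepCoPHOn.toCoPH (h : IsRecordOfRecord₁₃CSepCoPHOn F N Rg D w) : IsRecordOfRecord₁₃CCoPHOn F N Rg D w := by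
  obtain ⟨θ, hR, hk⟩ := h
  exact ⟨θ, hR, hk.toCoPH⟩

/-- … at the guard of record. [cite: Balaban1988Convergent, (3.16)–(3.22) pp.268–269 (bookkeeping)] -/
theorem IsDatumOfRecord₁₃CSepCoPHN.toCoPH (h : IsDatumOfRecord₁₃CSepCoPHN F N D) : IsDatumOfRecord₁₃CCoPHN F N D :=
  IsDatumOfRecord₁₃CSepCoPHOn.toCoPH h

/-- … at the guard of record, records. [cite: Balaban1988Convergent, (3.16)–(3.22) pp.268–269 (bookkeeping)] -/
theorem IsRecordOfRecord₁₃CSepCoPHN.toCoPH (h : IsRecordOfRecord₁₃CSepCoPHN F N D w) : IsRecordOfRecord₁₃CCoPHN F N D w :=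
  IsRecordOfRecord₁₃CSepCoPHOn.toCoPH h

end BridgeToCoPH

/-! ## §9. THE HISTORY-BLIND DOORS `…SepCoPR → …SepCoPH` along def-T's `Stage13HParams.ofHistoryBlind` (ONE-WAY; with def-T's `IsRecordOfRecord₁₃CSepCoPH.ofCoPR`, «K0⁷ ⇐ K0⁶» at class level)

Every v1.6 `SepCoPR`-keyed class instance IS a v1.7 `SepCoPH`-keyed one AT THE SAME DATUM (and world), the parameter being def-T's history-blind embedding
`Stage13HParams.ofHistoryBlind F N θ := ⟨θ, fun p _ _ _ => θ.Zr p⟩` (`Node00/Record13SepCoPH`: `Stage13RParams.Provisos₁₃SepCoPR.ofHistoryBlind`, `datumOfRecord₁₃SepCoPH_ofHistoryBlind`; `Node00/Record13CoPH`: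
`Stage13RParams.ZrUnity.ofHistoryBlind`, `Stage13HParams.toStage5₁₃CoPH_ofHistoryBlind`; admissibility and slot non-degeneracy are read through `toStage13Params` and pass definitionally).  NO CONVERSE: a
history-indexed residual need not be history-blind (FINDING №9) — nothing `SepCoPH → SepCoPR` is statable as an implication of classes and none is filed; the landed v1.5 → v1.6
run-blind doors of `Node00/Record13DatumKeySepCoPR` §9 compose with these (v1.5 → v1.7) and are not re-issued. -/

section HistoryBlindDoors

variable {F : T4Family} {N : ℕ} [NeZero N]
variable {D : FiniteEpsData F (SU N)} {w : WorldP}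

/-- **EVERY v1.6 DATUM OF RECORD (provisos of record) IS A v1.7 DATUM OF RECORD** (same datum; parameter `Stage13HParams.ofHistoryBlind F N h.params`).  One-way.
[cite: Balaban1989LargeFieldII, Thm 1 + (0.1) pp.355–356; Balaban1988Convergent, (3.16) p.268, (3.23) p.270 (bookkeeping)] -/
theorem IsDatumOfRecord₁₃CSepCoPH.ofCoPR (h : IsDatumOfRecord₁₃CSepCoPR F N D) : IsDatumOfRecord₁₃CSepCoPH F N D := by
  obtain ⟨θ, hP, hθ, hD⟩ := h
  exact ⟨Stage13HParams.ofHistoryBlind F N θ, hP.ofHistoryBlind, hθ, hD.trans (datumOfRecord₁₃SepCoPH_ofHistoryBlind hP).symm⟩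

/-- **EVERY v1.6 KEYED RECORD IS A v1.7 KEYED RECORD at the history-blind embedding of its parameter** (same datum, same world; the Stage-5 view by
`Stage13HParams.toStage5₁₃CoPH_ofHistoryBlind`).  One-way. [cite: Balaban1989LargeFieldII, Thm 1 + (0.1) pp.355–356 (bookkeeping)] -/
theorem IsRateKey₁₃SepCoPH.ofCoPR {θ : Stage13RParams F N} (hk : IsRateKey₁₃SepCoPR F N D w θ) : IsRateKey₁₃SepCoPH F N D w (Stage13HParams.ofHistoryBlind F N θ) := by
  obtain ⟨hP, hθ, hD, hC, hγ, hL, hup⟩ := hk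
  exact ⟨hP.ofHistoryBlind, hθ, hD.trans (datumOfRecord₁₃SepCoPH_ofHistoryBlind hP).symm, hC, hγ, hL,
    fun P => (hup P).trans (congrArg (fun ϑ => upOfRecord₅C F N ϑ P) (Stage13HParams.toStage5₁₃CoPH_ofHistoryBlind F N θ).symm)⟩

/-- **REGIME FORM, DATUM**: a v1.6 datum of record IN a regime `Rg` is a v1.7 datum of record in any regime `RgH` the history-blind embedding carries `Rg` into.  One-way.
[cite: Balaban1989LargeFieldII, Thm 1 + (0.1) pp.355–356 (bookkeeping)] -/
theorem IsDatumOfRecord₁₃CSepCoPHOn.ofCoPR {Rg : (F : T4Family) → Stage13RParams F N → Prop} {RgH : (F : T4Family) → Stage13HParams F N → Prop}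
    (hRg : ∀ (F : T4Family) (θ : Stage13RParams F N), Rg F θ → RgH F (Stage13HParams.ofHistoryBlind F N θ)) (h : IsDatumOfRecord₁₃CSepCoPROn F N Rg D) :
    IsDatumOfRecord₁₃CSepCoPHOn F N RgH D := by
  obtain ⟨θ, hP, hr, hθ, hD⟩ := h
  exact ⟨Stage13HParams.ofHistoryBlind F N θ, hP.ofHistoryBlind, hRg F θ hr, hθ, hD.trans (datumOfRecord₁₃SepCoPH_ofHistoryBlind hP).symm⟩

/-- **REGIME FORM, RECORD**: a v1.6 record IN a regime `Rg` is a v1.7 record in any regime `RgH` the history-blind embedding carries `Rg` into.  One-way.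
[cite: Balaban1989LargeFieldII, Thm 1 + (0.1) pp.355–356 (bookkeeping)] -/
theorem IsRecordOfRecord₁₃CSepCoPHOn.ofCoPR {Rg : (F : T4Family) → Stage13RParams F N → Prop} {RgH : (F : T4Family) → Stage13HParams F N → Prop}
    (hRg : ∀ (F : T4Family) (θ : Stage13RParams F N), Rg F θ → RgH F (Stage13HParams.ofHistoryBlind F N θ)) (h : IsRecordOfRecord₁₃CSepCoPROn F N Rg D w) :
    IsRecordOfRecord₁₃CSepCoPHOn F N RgH D w := by
  obtain ⟨θ, hr, hk⟩ := h
  exact ⟨Stage13HParams.ofHistoryBlind F N θ, hRg F θ hr, IsRateKey₁₃SepCoPH.ofCoPR hk⟩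

/-- **CN FORM, DATUM**: a v1.6 CN datum of record (guard `unityNondeg₁₃R N`) is a v1.7 CN datum of record (guard `unityNondeg₁₃H N`), the partition of unity transported by
def-T's `Stage13RParams.ZrUnity.ofHistoryBlind`, slot non-degeneracy definitionally.  One-way — the class-level body of «K0⁷ ⇐ K0⁶» up to the node conjuncts.
[cite: Balaban1988Convergent, (3.16)–(3.22) pp.268–269; Balaban1989LargeFieldII, Thm 1 p.355 (bookkeeping)] -/
theorem IsDatumOfRecord₁₃CSepCoPHN.ofCoPR (h : IsDatumOfRecord₁₃CSepCoPRN F N D) : IsDatumOfRecord₁₃CSepCoPHN F N D :=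
  IsDatumOfRecord₁₃CSepCoPHOn.ofCoPR (fun _ _ hG => ⟨hG.1.ofHistoryBlind, hG.2⟩) h

/-- **CN FORM, RECORD**: a v1.6 CN record is a v1.7 CN record (same datum, same world).  One-way.
[cite: Balaban1988Convergent, (3.16)–(3.22) pp.268–269; Balaban1989LargeFieldII, Thm 1 p.355 (bookkeeping)] -/
theorem IsRecordOfRecord₁₃CSepCoPHN.ofCoPR (h : IsRecordOfRecord₁₃CSepCoPRN F N D w) : IsRecordOfRecord₁₃CSepCoPHN F N D w :=
  IsRecordOfRecord₁₃CSepCoPHOn.ofCoPR (fun _ _ hG => ⟨hG.1.ofHistoryBlind, hG.2⟩) h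

end HistoryBlindDoors

end Literature.MathematicalPhysics.QuantumFieldTheory.Balaban1983to89.Node00

end
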